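import Literature.MathematicalPhysics.StatisticalMechanics.HardSphereContactTheorem
import Literature.MathematicalPhysics.KineticTheory.HardSphereVirialIdentity
import HarnessLib

/-!
# The contact theorem for the hard-sphere gas: proof

Topic `Literature/MathematicalPhysics/StatisticalMechanics`, proof file of the named fact
`HardSphereContactTheorem` (`HardSphereContactTheorem.lean`), discharged below as
`HardSphereContactTheorem_holds`.

Architecture (all pieces classical):
* the infinite-volume correlation functions `g = gLim σ` of the hard-sphere gas at small reduced
  density as Ruelle's Kirkwood–Salsburg fixed point (`StatisticalMechanics/HardSphereKirkwoodSalsburg`)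
  and the thermodynamic limit of the canonical correlation functions at contact scale
  (`KineticTheory/HardSphereCanonicalKSLimit`, `ksInv_eventually`);
* the finite-`N` virial identity `d⁺/dε Ξ_ε(n) = −C(n,2) 3ε² v₁ ⟨u_ε(contact)⟩`
  (`KineticTheory/HardSphereVirialIdentity`, `hasDerivWithinAt_XiT`), hence
  `f_N'(t) = ((N−1)/(2N)) v₁ ⟨v_N(contact)⟩_t` and, by the thermodynamic limit of the contact value
  and isotropy, `f_N' → (v₁/2) g₂(1⁺)` pointwise, boundedly;
* the fundamental theorem of calculus, dominated convergence and the additivity of `limsup` under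
  convergent perturbations give `f_ex(η) − f_ex(η₁) = ∫_{η₁}^{η} (v₁/2) g₂^{(t)}(1⁺) dt`; the contact
  value is continuous in the density (Lipschitz dependence of the Kirkwood–Salsburg fixed point on
  `(ρ, R)` and continuity of the limit insertion ratio `R(σ)`, proved here from the strict
  monotonicity of `R ↦ R F_σ(R)`), so `f_ex` is `C¹` with `f_ex'(η) = (2π/3) g₂(1⁺)`
  (`v₁ = 4π/3`), i.e. `contactValue (σ³) = g₂(1⁺)` — the virial theorem, Hansen–McDonald (2.5.26);
* the pair law of the canonical gas at contact scale is `ε³ ∫_S v_{N+1}(εq, 0) dq`, and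
  `v_{N+1}(εq, 0) → g₂(q, 0)` uniformly on bounded windows while `q ↦ g₂(q, 0)` is Lipschitz
  outside contact, which gives the uniform estimate on thin shells.

## Main results

* `continuousAt_ratioLimit`, `continuousAt_contactG` — continuity in the density of the limit insertion
  ratio `R(σ)` and of the contact value `contactG σ = g₂(e₀, 0)`; `gLim_two_eq_contactG` — isotropy;
* `abs_gLim_two_sub_le` — `q ↦ g₂(q, 0)` is Lipschitz outside contact;
* `hsFreeVolume_eq_XiT`, `hasDerivWithinAt_fN`, `tendsto_derivFN`, `hsExcessFreeEnergy_sub_eq`,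
  `hasDerivAt_hsExcessFreeEnergy`, `contactValue_eq_contactG` — the virial theorem
  `contactValue (σ³) = g₂(1⁺; σ)` at small density;
* `posGibbs_real_pairEvent`, `pair_estimate` — the canonical pair law at contact scale;
* `HardSphereContactTheorem_holds` — the discharge.

## References

* J.-P. Hansen, I. R. McDonald, *Theory of Simple Liquids*, 4th ed. (2013), §2.5.  [HansenMcdonald2013]
* D. Ruelle, *Statistical Mechanics: Rigorous Results* (1969), §4.2, Thm 4.2.3.  [Ruelle1969]
* E. Pulvirenti, D. Tsagkarogiannis, Comm. Math. Phys. 316 (2012) 289–306.  [PulvirentiTsagkarogiannis2012]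
-/

noncomputable section

open MeasureTheory Set Filter Function Metric
open scoped ENNReal BigOperators Topology Classical

namespace Literature.MathematicalPhysics.StatisticalMechanics

open KineticTheory Literature.Analysis.FluidPDE Literature.Analysis.FunctionSpaces
open scoped Pointwise

/-! ### Continuity of the limit insertion ratio `R(σ)` in the density -/

/-- `|a^j − b^j| ≤ j M^{j−1} |a − b|` for `a, b ∈ [0, M]`. [folklore] -/
theorem abs_pow_sub_pow_le_of_le {a b M : ℝ} (ha : 0 ≤ a) (haM : a ≤ M) (hb : 0 ≤ b) (hbM : b ≤ M) :
    ∀ j : ℕ, |a ^ j - b ^ j| ≤ j * M ^ (j - 1) * |a - b|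
  | 0 => by simp
  | j + 1 => by
    have ih := abs_pow_sub_pow_le_of_le ha haM hb hbM j
    have hM : 0 ≤ M := ha.trans haM
    have e : a ^ (j + 1) - b ^ (j + 1) = a * (a ^ j - b ^ j) + (a - b) * b ^ j := by ring
    rw [e]
    calc |a * (a ^ j - b ^ j) + (a - b) * b ^ j| ≤ |a| * |a ^ j - b ^ j| + |a - b| * |b ^ j| := by
          refine (abs_add_le _ _).trans ?_; rw [abs_mul, abs_mul]
      _ ≤ M * (j * M ^ (j - 1) * |a - b|) + |a - b| * M ^ j := by
          refine add_le_add (mul_le_mul (by rwa [abs_of_nonneg ha]) ih (abs_nonneg _) hM)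
            (mul_le_mul_of_nonneg_left ?_ (abs_nonneg _))
          rw [abs_pow, abs_of_nonneg hb]; exact pow_le_pow_left₀ hb hbM j
      _ = ((j + 1 : ℕ) : ℝ) * M ^ (j + 1 - 1) * |a - b| := by
          cases j with
          | zero => simp
          | succ j => push_cast; ring

/-- The limit coefficients of the uniform profile are the cluster coefficients. [folklore] -/
theorem coefLim_uniform (σ : ℝ) (j : ℕ) : coefLim uniformProfile σ (fun _ => 1) j = clusterCoeff σ j := by
  rw [coefLim]; simp [uniformProfile]

/-- `θ = 2 e v₁ σ³` for the uniform profile. [folklore] -/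
theorem geomRatio_uniform (σ : ℝ) : geomRatio uniformProfile σ = 2 * Real.exp 1 * (v₁ * σ ^ 3) := by
  rw [geomRatio, ovDensity_uniformProfile]

/-- `θ` is monotone in `σ ≥ 0`. [folklore] -/
theorem geomRatio_uniform_mono {σ σ' : ℝ} (hσ : 0 ≤ σ) (h : σ ≤ σ') :
    geomRatio uniformProfile σ ≤ geomRatio uniformProfile σ' := by
  rw [geomRatio_uniform, geomRatio_uniform]
  have := v₁_pos
  gcongr

/-- The bound on the pure numbers `b_j`: `|b_j|/j! ≤ e (e v₁)ʲ`. [folklore] -/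
theorem abs_bE_div_factorial_le {σ : ℝ} (hσ : 0 < σ) (hσ2 : σ < 1 / 2) (j : ℕ) :
    |bE j| / (Nat.factorial j : ℝ) ≤ Real.exp 1 * (Real.exp 1 * v₁) ^ j := by
  have h := abs_clusterCoeff_le hσ hσ2 j
  rw [clusterCoeff, abs_mul, abs_div, abs_pow, abs_of_pos (pow_pos hσ 3), Nat.abs_cast] at h
  have hρ : 0 < (σ ^ 3) ^ j := pow_pos (pow_pos hσ 3) j
  have e1 : (σ ^ 3) ^ j / (Nat.factorial j : ℝ) * |bE j| = (|bE j| / (Nat.factorial j : ℝ)) * (σ ^ 3) ^ j := by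
    ring
  have e2 : Real.exp 1 * (Real.exp 1 * (v₁ * σ ^ 3)) ^ j = (Real.exp 1 * (Real.exp 1 * v₁) ^ j) * (σ ^ 3) ^ j := by
    rw [mul_pow, mul_pow, mul_pow]; ring
  rw [e1, e2] at h
  exact le_of_mul_le_mul_right h hρ

/-- The termwise Lipschitz bound in `R`: `|γ_j R₂ʲ − γ_j R₁ʲ| ≤ (e/2) |R₂ − R₁| · j θʲ` on `[0, 2]`.
[folklore] -/
theorem abs_coef_mul_pow_sub_le {σ : ℝ} (hσ : 0 < σ) (hσ2 : σ < 1 / 2) {R₁ R₂ : ℝ}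
    (h1 : R₁ ∈ Icc (0 : ℝ) 2) (h2 : R₂ ∈ Icc (0 : ℝ) 2) (j : ℕ) :
    ‖clusterCoeff σ j * R₂ ^ j - clusterCoeff σ j * R₁ ^ j‖ ≤
      Real.exp 1 / 2 * |R₂ - R₁| * (j * geomRatio uniformProfile σ ^ j) := by
  have hv := v₁_pos
  rw [← mul_sub, Real.norm_eq_abs, abs_mul]
  have hc := abs_clusterCoeff_le hσ hσ2 j
  have hp := abs_pow_sub_pow_le_of_le h2.1 h2.2 h1.1 h1.2 j
  calc |clusterCoeff σ j| * |R₂ ^ j - R₁ ^ j|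
      ≤ (Real.exp 1 * (Real.exp 1 * (v₁ * σ ^ 3)) ^ j) * (j * 2 ^ (j - 1) * |R₂ - R₁|) :=
        mul_le_mul hc hp (abs_nonneg _) (by positivity)
    _ = Real.exp 1 / 2 * |R₂ - R₁| * (j * geomRatio uniformProfile σ ^ j) := by
        rw [geomRatio_uniform]
        cases j with
        | zero => simp
        | succ j =>
          simp only [Nat.add_sub_cancel]
          rw [mul_pow (2 * Real.exp 1), mul_pow 2 (Real.exp 1), mul_pow (Real.exp 1) (v₁ * σ ^ 3),
            pow_succ (2 : ℝ) j]
          ring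

/-- The termwise continuity bound in `σ`: `|γ_j(σ) − γ_j(σ')| |R|ʲ ≤ (e/σ_b³)|σ³ − σ'³| · j θ_bʲ`.
[folklore] -/
theorem abs_coef_sub_coef_mul_pow_le {σ σ' σb : ℝ} (hb0 : 0 < σb) (hb2 : σb < 1 / 2) (hσ : 0 ≤ σ)
    (hσb : σ ≤ σb) (hσ' : 0 ≤ σ') (hσ'b : σ' ≤ σb) {R : ℝ} (hRa : |R| ≤ 2) (j : ℕ) :
    ‖clusterCoeff σ j * R ^ j - clusterCoeff σ' j * R ^ j‖ ≤
      Real.exp 1 / σb ^ 3 * |σ ^ 3 - σ' ^ 3| * (j * geomRatio uniformProfile σb ^ j) := by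
  have hv := v₁_pos
  have hρb0 : 0 < σb ^ 3 := pow_pos hb0 3
  have hρ : σ ^ 3 ≤ σb ^ 3 := pow_le_pow_left₀ hσ hσb 3
  have hρ' : σ' ^ 3 ≤ σb ^ 3 := pow_le_pow_left₀ hσ' hσ'b 3
  rw [← sub_mul, Real.norm_eq_abs, abs_mul, clusterCoeff, clusterCoeff, ← sub_mul, abs_mul, ← sub_div,
    abs_div, Nat.abs_cast, abs_pow]
  have hB := abs_bE_div_factorial_le hb0 hb2 j
  have hP := abs_pow_sub_pow_le_of_le (pow_nonneg hσ 3) hρ (pow_nonneg hσ' 3) hρ' j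
  have hRj : |R| ^ j ≤ 2 ^ j := pow_le_pow_left₀ (abs_nonneg _) hRa j
  calc |(σ ^ 3) ^ j - (σ' ^ 3) ^ j| / (Nat.factorial j : ℝ) * |bE j| * |R| ^ j
      = |(σ ^ 3) ^ j - (σ' ^ 3) ^ j| * (|bE j| / (Nat.factorial j : ℝ)) * |R| ^ j := by ring
    _ ≤ (j * (σb ^ 3) ^ (j - 1) * |σ ^ 3 - σ' ^ 3|) * (Real.exp 1 * (Real.exp 1 * v₁) ^ j) * 2 ^ j :=
        mul_le_mul (mul_le_mul hP hB (by positivity) (by positivity)) hRj (by positivity) (by positivity)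
    _ = Real.exp 1 / σb ^ 3 * |σ ^ 3 - σ' ^ 3| * (j * geomRatio uniformProfile σb ^ j) := by
        rw [geomRatio_uniform]
        cases j with
        | zero => simp
        | succ j =>
          simp only [Nat.add_sub_cancel]
          rw [mul_pow (2 * Real.exp 1), mul_pow 2 (Real.exp 1), mul_pow (Real.exp 1) v₁, mul_pow v₁,
            pow_succ (σb ^ 3) j]
          field_simp

section RatioLimit

variable {σ : ℝ} (h : SmallDensity uniformProfile σ)
include h

/-- **Lipschitz continuity of `F_σ(R) = ∑ γ_j Rʲ` in `R ∈ [0, 2]`** with constant `κ/2`,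
`κ = contractionC`. [folklore] -/
theorem abs_ratioSeries_sub_le {R₁ R₂ : ℝ} (h1 : R₁ ∈ Icc (0 : ℝ) 2) (h2 : R₂ ∈ Icc (0 : ℝ) 2) :
    |ratioSeries uniformProfile σ R₂ - ratioSeries uniformProfile σ R₁| ≤
      contractionC uniformProfile σ / 2 * |R₂ - R₁| := by
  have hσ := h.σ_pos
  have hσ2 := h.σ_lt_half
  have hθ0 : 0 ≤ geomRatio uniformProfile σ := h.geomRatio_nonneg
  have hθ1 := h.geomRatio_lt_one
  have hs1 := summable_ratioSeries (P := uniformProfile) hσ hσ2 hθ1 (R := R₁)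
    (abs_le.2 ⟨by linarith [h1.1], h1.2⟩)
  have hs2 := summable_ratioSeries (P := uniformProfile) hσ hσ2 hθ1 (R := R₂)
    (abs_le.2 ⟨by linarith [h2.1], h2.2⟩)
  rw [ratioSeries, ratioSeries, ← hs2.tsum_sub hs1]
  simp only [coefLim_uniform]
  have hnorm : ‖geomRatio uniformProfile σ‖ < 1 := by rwa [Real.norm_eq_abs, abs_of_nonneg hθ0]
  have hmaj := (hasSum_coe_mul_geometric_of_norm_lt_one (𝕜 := ℝ) hnorm).mul_left (Real.exp 1 / 2 * |R₂ - R₁|)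
  have := tsum_of_norm_bounded hmaj (abs_coef_mul_pow_sub_le hσ hσ2 h1 h2)
  rw [Real.norm_eq_abs] at this
  refine this.trans (le_of_eq ?_)
  rw [contractionC]; ring

/-- **Strict monotonicity of `R ↦ R F_σ(R)` on `[1/2, 2]`** with constant `1/4`:
`|R₂ − R₁| ≤ 4 |R₂ F(R₂) − R₁ F(R₁)|`. [folklore] -/
theorem abs_sub_le_four_mul {R₁ R₂ : ℝ} (h1 : R₁ ∈ Icc (1 / 2 : ℝ) 2) (h2 : R₂ ∈ Icc (1 / 2 : ℝ) 2) :
    |R₂ - R₁| ≤ 4 * |R₂ * ratioSeries uniformProfile σ R₂ - R₁ * ratioSeries uniformProfile σ R₁| := by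
  have hσ := h.σ_pos
  have hσ2 := h.σ_lt_half
  have hθ1 := h.geomRatio_lt_one
  have hκ := h.four_contractionC_lt_one
  have hκ0 : 0 ≤ contractionC uniformProfile σ := h.contractionC_nonneg
  have hφ := h.phi_lt_half
  have hF : ∀ R ∈ Icc (1 / 2 : ℝ) 2, 1 / 2 ≤ ratioSeries uniformProfile σ R := by
    intro R hR
    have := abs_ratioSeries_sub_one_le (P := uniformProfile) hσ hσ2 hθ1 (R := R)
      (abs_le.2 ⟨by linarith [hR.1], hR.2⟩)
    rw [abs_le] at this
    linarith [this.1]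
  wlog hle : R₁ ≤ R₂ generalizing R₁ R₂
  · have := this h2 h1 (le_of_not_ge hle)
    rwa [abs_sub_comm, abs_sub_comm (R₁ * _)] at this
  have hL := abs_ratioSeries_sub_le h ⟨by linarith [h1.1], h1.2⟩ ⟨by linarith [h2.1], h2.2⟩
  rw [abs_of_nonneg (sub_nonneg.2 hle)] at hL ⊢
  rw [abs_le] at hL
  have hF2 := hF R₂ h2
  have hR1 : (0 : ℝ) ≤ R₁ := by linarith [h1.1]
  have key : R₂ * ratioSeries uniformProfile σ R₂ - R₁ * ratioSeries uniformProfile σ R₁ =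
      (R₂ - R₁) * ratioSeries uniformProfile σ R₂ +
        R₁ * (ratioSeries uniformProfile σ R₂ - ratioSeries uniformProfile σ R₁) := by ring
  have t1 : (R₂ - R₁) * (1 / 2) ≤ (R₂ - R₁) * ratioSeries uniformProfile σ R₂ :=
    mul_le_mul_of_nonneg_left hF2 (sub_nonneg.2 hle)
  have t2 : -(R₁ * (contractionC uniformProfile σ / 2 * (R₂ - R₁))) ≤
      R₁ * (ratioSeries uniformProfile σ R₂ - ratioSeries uniformProfile σ R₁) := by
    have := mul_le_mul_of_nonneg_left hL.1 hR1
    linarith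
  have t3 : R₁ * (contractionC uniformProfile σ / 2 * (R₂ - R₁)) ≤ (R₂ - R₁) / 4 := by
    have hc8 : contractionC uniformProfile σ / 2 ≤ 1 / 8 := by linarith
    calc R₁ * (contractionC uniformProfile σ / 2 * (R₂ - R₁)) ≤ 2 * (1 / 8 * (R₂ - R₁)) :=
          mul_le_mul h1.2 (mul_le_mul_of_nonneg_right hc8 (sub_nonneg.2 hle)) (by positivity) (by norm_num)
      _ = (R₂ - R₁) / 4 := by ring
  have hlow : (R₂ - R₁) / 4 ≤ R₂ * ratioSeries uniformProfile σ R₂ - R₁ * ratioSeries uniformProfile σ R₁ := by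
    rw [key]; linarith
  rw [abs_of_nonneg (by linarith [div_nonneg (sub_nonneg.2 hle) (by norm_num : (0:ℝ) ≤ 4)])]
  linarith

end RatioLimit

/-- **Continuity of `F_σ(R)` in `σ`**: for `0 < σ, σ' ≤ σ_b` (`σ_b` small) and `R ∈ [0, 2]`,
`|F_σ(R) − F_{σ'}(R)| ≤ (2 e² v₁/(1 − θ_b)²) |σ³ − σ'³|`. [folklore] -/
theorem abs_ratioSeries_sub_sigma_le {σ σ' σb : ℝ} (hb : SmallDensity uniformProfile σb) (hσ : 0 < σ)
    (hσb : σ ≤ σb) (hσ' : 0 < σ') (hσ'b : σ' ≤ σb) {R : ℝ} (hR : R ∈ Icc (0 : ℝ) 2) :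
    |ratioSeries uniformProfile σ R - ratioSeries uniformProfile σ' R| ≤
      2 * Real.exp 1 ^ 2 * v₁ / (1 - geomRatio uniformProfile σb) ^ 2 * |σ ^ 3 - σ' ^ 3| := by
  have hv := v₁_pos
  have hb0 := hb.σ_pos
  have hb2 := hb.σ_lt_half
  have hθb0 : 0 ≤ geomRatio uniformProfile σb := hb.geomRatio_nonneg
  have hθb1 := hb.geomRatio_lt_one
  have hθ : geomRatio uniformProfile σ < 1 := (geomRatio_uniform_mono hσ.le hσb).trans_lt hθb1
  have hθ' : geomRatio uniformProfile σ' < 1 := (geomRatio_uniform_mono hσ'.le hσ'b).trans_lt hθb1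
  have hRa : |R| ≤ 2 := abs_le.2 ⟨by linarith [hR.1], hR.2⟩
  have hs := summable_ratioSeries (P := uniformProfile) hσ (by linarith) hθ hRa
  have hs' := summable_ratioSeries (P := uniformProfile) hσ' (by linarith) hθ' hRa
  rw [ratioSeries, ratioSeries, ← hs.tsum_sub hs']
  simp only [coefLim_uniform]
  have hnorm : ‖geomRatio uniformProfile σb‖ < 1 := by rwa [Real.norm_eq_abs, abs_of_nonneg hθb0]
  have hmaj := (hasSum_coe_mul_geometric_of_norm_lt_one (𝕜 := ℝ) hnorm).mul_left
    (Real.exp 1 / σb ^ 3 * |σ ^ 3 - σ' ^ 3|)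
  have := tsum_of_norm_bounded hmaj (abs_coef_sub_coef_mul_pow_le hb0 hb2 hσ.le hσb hσ'.le hσ'b hRa)
  rw [Real.norm_eq_abs] at this
  refine this.trans (le_of_eq ?_)
  rw [geomRatio_uniform]
  have hρb0 : σb ^ 3 ≠ 0 := (pow_pos hb0 3).ne'
  field_simp

/-- **The limit insertion ratio is locally Lipschitz in `σ³`**:
`|R(σ) − R(σ')| ≤ 8 · (2e²v₁/(1−θ_b)²) |σ³ − σ'³|` at small density. [folklore] -/
theorem abs_ratioLimit_sub_le {σ σ' σb : ℝ} (hb : SmallDensity uniformProfile σb)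
    (h : SmallDensity uniformProfile σ) (h' : SmallDensity uniformProfile σ') (hσb : σ ≤ σb) (hσ'b : σ' ≤ σb) :
    |ratioLimit uniformProfile σ - ratioLimit uniformProfile σ'| ≤
      8 * (2 * Real.exp 1 ^ 2 * v₁ / (1 - geomRatio uniformProfile σb) ^ 2) * |σ ^ 3 - σ' ^ 3| := by
  have hv := v₁_pos
  set R := ratioLimit uniformProfile σ with hR
  set R' := ratioLimit uniformProfile σ' with hR'
  have hspec := (ratioLimit_spec (P := uniformProfile) h.σ_pos h.σ_lt_half h.geomRatio_lt_one h.phi_lt_half)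
  have hspec' := (ratioLimit_spec (P := uniformProfile) h'.σ_pos h'.σ_lt_half h'.geomRatio_lt_one
    h'.phi_lt_half)
  have hRm : R ∈ Icc (1 / 2 : ℝ) 2 := hspec.1
  have hR'm : R' ∈ Icc (1 / 2 : ℝ) 2 := hspec'.1
  have h1 := abs_sub_le_four_mul h hR'm hRm
  rw [hspec.2, show (1 : ℝ) = R' * ratioSeries uniformProfile σ' R' from hspec'.2.symm, ← mul_sub, abs_mul,
    abs_of_nonneg (by linarith [hR'm.1] : (0 : ℝ) ≤ R'),
    abs_sub_comm (ratioSeries uniformProfile σ' R') (ratioSeries uniformProfile σ R')] at h1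
  have h2 := abs_ratioSeries_sub_sigma_le hb h.σ_pos hσb h'.σ_pos hσ'b (R := R') ⟨by linarith [hR'm.1], hR'm.2⟩
  set L := 2 * Real.exp 1 ^ 2 * v₁ / (1 - geomRatio uniformProfile σb) ^ 2 with hL
  have hL0 : 0 ≤ L := by positivity
  calc |R - R'| ≤ 4 * (R' * |ratioSeries uniformProfile σ R' - ratioSeries uniformProfile σ' R'|) := h1
    _ ≤ 4 * (2 * (L * |σ ^ 3 - σ' ^ 3|)) :=
        mul_le_mul_of_nonneg_left (mul_le_mul hR'm.2 h2 (abs_nonneg _) (by norm_num)) (by norm_num)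
    _ = 8 * L * |σ ^ 3 - σ' ^ 3| := by ring

/-- **Continuity of `σ ↦ R(σ)`** on the small-density interval. [folklore] -/
theorem continuousAt_ratioLimit {σ₁ σ₀ : ℝ} (hsd : ∀ σ, 0 < σ → σ < σ₁ → SmallDensity uniformProfile σ)
    (h0 : 0 < σ₀) (h1 : σ₀ < σ₁) : ContinuousAt (fun σ => ratioLimit uniformProfile σ) σ₀ := by
  set σb := (σ₀ + σ₁) / 2 with hσb
  have hb1 : σb < σ₁ := by rw [hσb]; linarith
  have hb0 : σ₀ < σb := by rw [hσb]; linarith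
  have hb : SmallDensity uniformProfile σb := hsd σb (h0.trans hb0) hb1
  set L := 8 * (2 * Real.exp 1 ^ 2 * v₁ / (1 - geomRatio uniformProfile σb) ^ 2) with hL
  have hev : ∀ᶠ σ in 𝓝 σ₀, ‖ratioLimit uniformProfile σ - ratioLimit uniformProfile σ₀‖ ≤ L * |σ ^ 3 - σ₀ ^ 3| := by
    filter_upwards [Ioo_mem_nhds h0 hb0] with σ hσ
    rw [Real.norm_eq_abs]
    exact abs_ratioLimit_sub_le hb (hsd σ hσ.1 (hσ.2.trans hb1)) (hsd σ₀ h0 h1) hσ.2.le hb0.le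
  have hlim : Tendsto (fun σ : ℝ => L * |σ ^ 3 - σ₀ ^ 3|) (𝓝 σ₀) (𝓝 0) := by
    have : Tendsto (fun σ : ℝ => σ ^ 3 - σ₀ ^ 3) (𝓝 σ₀) (𝓝 0) := by
      have := ((continuous_pow 3).tendsto σ₀).sub_const (σ₀ ^ 3)
      rwa [sub_self] at this
    have := (this.abs).const_mul L
    rwa [abs_zero, mul_zero] at this
  rw [ContinuousAt, tendsto_iff_norm_sub_tendsto_zero]
  exact squeeze_zero' (Eventually.of_forall fun σ => norm_nonneg _) hev hlim

/-! ### The infinite-volume contact value: isotropy and continuity in the density -/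

/-- The reference direction `e₀ = (1, 0, 0)`. [folklore] -/
def e0 : E3 := EuclideanSpace.single 0 1

/-- `‖e₀‖ = 1`. [folklore] -/
theorem norm_e0 : ‖e0‖ = 1 := by simp [e0]

/-- **The contact value** `g₂(1⁺; σ³) := g₂(e₀, 0)` of the infinite-volume pair correlation function
of the hard-sphere gas at reduced density `σ³` (density normalisation). [cite: HansenMcdonald2013, §2.5] -/
def contactG (σ : ℝ) : ℝ := gLim σ 2 ![e0, 0]

section Contact

variable {σ : ℝ} (h : SmallDensity uniformProfile σ)
include h

/-- **Isotropy of the contact value**: `g₂(ω, 0) = g₂(e₀, 0)` for every unit vector `ω`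
(reflection symmetry of the Kirkwood–Salsburg fixed point). [cite: Ruelle1969, §4.2.3 Thm 4.2.3] -/
theorem gLim_two_eq_contactG {ω : E3} (hω : ‖ω‖ = 1) : gLim σ 2 ![ω, 0] = contactG σ := by
  set A : E3 ≃ₗᵢ[ℝ] E3 := ((ℝ ∙ (ω - e0))ᗮ).reflection with hA
  have hAω : A ω = e0 := Submodule.reflection_sub (by rw [hω, norm_e0])
  have hiso := HardSphereKS.ksCorr_linearIsometryEquiv (E := E3) (ρ := σ ^ 3)
    (R := ratioLimit uniformProfile σ) (ξ := 3) (by norm_num) (ksRatio_three_lt_one h) A 2 ![ω, 0]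
  have hcfg : (fun i => A ((![ω, 0] : Fin 2 → E3) i)) = ![e0, 0] := by
    funext i
    refine Fin.cases ?_ (fun j => ?_) i
    · simp [hAω]
    · fin_cases j; simp
  rw [hcfg] at hiso
  rw [contactG, gLim]
  exact hiso.symm

/-- `|contactG| ≤ 9`. [folklore] -/
theorem abs_contactG_le : |contactG σ| ≤ 9 := by
  have := abs_gLim_le h 2 ![e0, 0]
  rw [contactG]; norm_num at this ⊢; exact this

end Contact

/-- **Continuity of the contact value in the density**: at every small `σ₀ > 0`,
`σ ↦ g₂(1⁺; σ³)` is continuous (Lipschitz dependence of the Kirkwood–Salsburg fixed point on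
`(ρ, R)` and continuity of `R(σ)`). [cite: Ruelle1969, §4.2.3 Thm 4.2.3] -/
theorem continuousAt_contactG {σ₁ σ₀ : ℝ} (hσ₁ : σ₁ ≤ 1)
    (hsd : ∀ σ, 0 < σ → σ < σ₁ → SmallDensity uniformProfile σ) (h0 : 0 < σ₀) (h1 : σ₀ < σ₁) :
    ContinuousAt contactG σ₀ := by
  have hv : 0 < v₁ := v₁_pos
  have hsd0 := hsd σ₀ h0 h1
  set θ₀ := HardSphereKS.ksRatio E3 (σ₀ ^ 3) (ratioLimit uniformProfile σ₀) 3 with hθ₀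
  have hθ₀1 : θ₀ < 1 := ksRatio_three_lt_one hsd0
  set K := 3⁻¹ * Real.exp (2 * v₁ * 3) / (1 - θ₀) * 3 ^ 2 with hK
  have hK0 : 0 ≤ K := by
    have : 0 < 1 - θ₀ := by linarith
    positivity
  -- the Lipschitz estimate near `σ₀`
  have hev : ∀ᶠ σ in 𝓝 σ₀, ‖contactG σ - contactG σ₀‖ ≤
      K * (|ratioLimit uniformProfile σ₀ - ratioLimit uniformProfile σ| + 2 * |σ₀ ^ 3 - σ ^ 3|) := by
    filter_upwards [Ioo_mem_nhds h0 h1] with σ hσ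
    have hsdσ := hsd σ hσ.1 hσ.2
    have hb := HardSphereKS.abs_ksCorr_sub_ksCorr_le (E := E3) (ξ := 3) (by norm_num)
      (ksRatio_three_lt_one hsd0) (ksRatio_three_lt_one hsdσ) 2 ![e0, 0]
    rw [Real.norm_eq_abs, contactG, contactG, gLim, gLim]
    refine hb.trans ?_
    rw [v1_E3_eq]
    have hR2 : |ratioLimit uniformProfile σ| ≤ 2 := by
      rw [abs_of_pos hsdσ.ratioLimit_pos]; exact hsdσ.ratioLimit_mem.2
    have hmax : max |σ₀ ^ 3| |σ ^ 3| + 1 ≤ 2 := by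
      have h1' : |σ₀ ^ 3| ≤ 1 := by
        rw [abs_of_pos (pow_pos h0 3)]; exact pow_le_one₀ h0.le (by linarith)
      have h2' : |σ ^ 3| ≤ 1 := by
        rw [abs_of_pos (pow_pos hσ.1 3)]; exact pow_le_one₀ hσ.1.le (by linarith [hσ.2])
      have := max_le h1' h2'
      linarith
    have hexp : Real.exp ((max |σ₀ ^ 3| |σ ^ 3| + 1) * v₁ * 3) ≤ Real.exp (2 * v₁ * 3) :=
      Real.exp_le_exp.2 (by nlinarith)
    have h1θ : 0 < 1 - θ₀ := by linarith
    have hnum : |ratioLimit uniformProfile σ₀ - ratioLimit uniformProfile σ| +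
        |ratioLimit uniformProfile σ| * |σ₀ ^ 3 - σ ^ 3| ≤
          |ratioLimit uniformProfile σ₀ - ratioLimit uniformProfile σ| + 2 * |σ₀ ^ 3 - σ ^ 3| := by
      have := mul_le_mul_of_nonneg_right hR2 (abs_nonneg (σ₀ ^ 3 - σ ^ 3))
      linarith
    calc (|ratioLimit uniformProfile σ₀ - ratioLimit uniformProfile σ| +
          |ratioLimit uniformProfile σ| * |σ₀ ^ 3 - σ ^ 3|) * 3⁻¹ *
            Real.exp ((max |σ₀ ^ 3| |σ ^ 3| + 1) * v₁ * 3) / (1 - θ₀) * 3 ^ 2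
        ≤ (|ratioLimit uniformProfile σ₀ - ratioLimit uniformProfile σ| + 2 * |σ₀ ^ 3 - σ ^ 3|) * 3⁻¹ *
            Real.exp (2 * v₁ * 3) / (1 - θ₀) * 3 ^ 2 := by
          gcongr
      _ = K * (|ratioLimit uniformProfile σ₀ - ratioLimit uniformProfile σ| + 2 * |σ₀ ^ 3 - σ ^ 3|) := by
          rw [hK]; ring
  have hlim : Tendsto (fun σ : ℝ => K * (|ratioLimit uniformProfile σ₀ - ratioLimit uniformProfile σ| +
      2 * |σ₀ ^ 3 - σ ^ 3|)) (𝓝 σ₀) (𝓝 0) := by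
    have hRc := continuousAt_ratioLimit hsd h0 h1
    have t1 : Tendsto (fun σ : ℝ => |ratioLimit uniformProfile σ₀ - ratioLimit uniformProfile σ|) (𝓝 σ₀) (𝓝 0) := by
      have := (tendsto_const_nhds (x := ratioLimit uniformProfile σ₀)).sub hRc
      rw [sub_self] at this
      simpa using this.abs
    have t2 : Tendsto (fun σ : ℝ => 2 * |σ₀ ^ 3 - σ ^ 3|) (𝓝 σ₀) (𝓝 0) := by
      have := (tendsto_const_nhds (x := σ₀ ^ 3)).sub ((continuous_pow 3).tendsto σ₀)
      rw [sub_self] at this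
      simpa using (this.abs).const_mul 2
    simpa using (t1.add t2).const_mul K
  rw [ContinuousAt, tendsto_iff_norm_sub_tendsto_zero]
  exact squeeze_zero' (Eventually.of_forall fun σ => norm_nonneg _) hev hlim

/-! ### Lipschitz continuity of `q ↦ g₂(q, 0)` outside contact -/

/-- `ballProd a` is the product of the one-point indicators. [folklore] -/
theorem ballProd_eq_prod (a : E3) {j : ℕ} (y : Fin j → E3) :
    HardSphereKS.ballProd a y = ∏ k, (ball a 1).indicator (1 : E3 → ℝ) (y k) := by
  unfold HardSphereKS.ballProd
  by_cases hy : ∀ k, dist (y k) a < 1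
  · rw [if_pos hy]
    exact (Finset.prod_eq_one fun k _ => by rw [indicator_of_mem (mem_ball.2 (hy k))]; rfl).symm
  · rw [if_neg hy]
    push Not at hy
    obtain ⟨k, hk⟩ := hy
    exact (Finset.prod_eq_zero (Finset.mem_univ k)
      (indicator_of_notMem (show y k ∉ ball a 1 by rw [mem_ball, not_lt]; exact hk) _)).symm

/-- The hybrid indicators `H_i(y) = ∏_{k<i} 𝟙_{B(a')}(y_k) ∏_{k≥i} 𝟙_{B(a)}(y_k)`. [folklore] -/
def hyb (a a' : E3) (j i : ℕ) (y : Fin j → E3) : ℝ :=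
  ∏ k : Fin j, if (k : ℕ) < i then (ball a' 1).indicator (1 : E3 → ℝ) (y k) else (ball a 1).indicator 1 (y k)

/-- `H_0 = ballProd a`. [folklore] -/
theorem hyb_zero (a a' : E3) {j : ℕ} (y : Fin j → E3) : hyb a a' j 0 y = HardSphereKS.ballProd a y := by
  rw [ballProd_eq_prod]; simp [hyb]

/-- `H_j = ballProd a'`. [folklore] -/
theorem hyb_self (a a' : E3) {j : ℕ} (y : Fin j → E3) : hyb a a' j j y = HardSphereKS.ballProd a' y := by
  rw [ballProd_eq_prod]; simp [hyb, Fin.is_lt]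

/-- An indicator of a unit ball lies in `[0, 1]`. [folklore] -/
theorem indicator_ball_mem (a z : E3) : (ball a 1).indicator (1 : E3 → ℝ) z ∈ Icc (0 : ℝ) 1 := by
  by_cases hz : z ∈ ball a 1
  · rw [indicator_of_mem hz]; exact ⟨zero_le_one, le_rfl⟩
  · rw [indicator_of_notMem hz]; exact ⟨le_rfl, zero_le_one⟩

/-- The integral of the indicator of a unit ball is `v₁`. [folklore] -/
theorem integral_indicator_ball (a : E3) : ∫ z, (ball a 1).indicator (1 : E3 → ℝ) z = v₁ := by
  rw [integral_indicator_one _root_.measurableSet_ball, measureReal_def, Measure.addHaar_ball_center, v₁]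

/-- **The `L¹` size of the difference of two unit-ball indicators**: `∫ |𝟙_{B(a)} − 𝟙_{B(a')}| ≤ 6 v₁ ‖a − a'‖`
(`‖a − a'‖ ≤ 1`). [folklore] -/
theorem integral_abs_indicator_sub_le {a a' : E3} (hd : dist a a' ≤ 1) :
    ∫ z, |(ball a 1).indicator (1 : E3 → ℝ) z - (ball a' 1).indicator 1 z| ≤ 6 * v₁ * dist a a' := by
  have hv := v₁_pos
  set d := dist a a' with hdd
  have hd0 : 0 ≤ d := dist_nonneg
  -- one-sided shells
  have hshell : ∀ b b' : E3, dist b b' = d →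
      volume.real (ball b 1 \ ball b' 1) ≤ 3 * v₁ * d := by
    intro b b' hbb'
    have hsub : ball b 1 \ ball b' 1 ⊆ ball b 1 \ ball b (1 - d) := by
      intro z hz
      refine ⟨hz.1, fun hz' => hz.2 ?_⟩
      rw [mem_ball] at hz' ⊢
      calc dist z b' ≤ dist z b + dist b b' := dist_triangle _ _ _
        _ < (1 - d) + d := by rw [hbb']; linarith
        _ = 1 := by ring
    have hfin : Module.finrank ℝ E3 = 3 := finrank_euclideanSpace_fin
    calc volume.real (ball b 1 \ ball b' 1) ≤ volume.real (ball b 1 \ ball b (1 - d)) :=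
          measureReal_mono hsub (measure_ne_top_of_subset sdiff_subset measure_ball_lt_top.ne)
      _ = v₁ - (1 - d) ^ 3 * v₁ := by
          rw [measureReal_sdiff (ball_subset_ball (by linarith)) _root_.measurableSet_ball, measureReal_def,
            measureReal_def, Measure.addHaar_ball_center, Measure.addHaar_ball volume _ (by linarith : (0:ℝ) ≤ 1 - d),
            hfin, ENNReal.toReal_mul, ENNReal.toReal_ofReal (by positivity), v₁]
      _ ≤ 3 * v₁ * d := by nlinarith [mul_nonneg (mul_nonneg hd0 hd0) hv.le, mul_nonneg hd0 hv.le]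
  -- pointwise: `|𝟙_B − 𝟙_{B'}| ≤ 𝟙_{B ∖ B'} + 𝟙_{B' ∖ B}`
  have hpt : ∀ z, |(ball a 1).indicator (1 : E3 → ℝ) z - (ball a' 1).indicator 1 z| ≤
      (ball a 1 \ ball a' 1).indicator (1 : E3 → ℝ) z + (ball a' 1 \ ball a 1).indicator 1 z := by
    intro z
    by_cases h1 : z ∈ ball a 1 <;> by_cases h2 : z ∈ ball a' 1 <;>
      simp [indicator_of_mem, indicator_of_notMem, h1, h2]
  have hint : ∀ s : Set E3, MeasurableSet s → volume s < ∞ → Integrable (s.indicator (1 : E3 → ℝ)) := by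
    intro s hs hfin
    exact (integrable_indicator_iff hs).2 (integrableOn_const hfin.ne)
  have hi1 := hint (ball a 1 \ ball a' 1) (_root_.measurableSet_ball.diff _root_.measurableSet_ball)
    ((measure_mono sdiff_subset).trans_lt (measure_ball_lt_top (μ := (volume : Measure E3)) (x := a) (r := 1)))
  have hi2 := hint (ball a' 1 \ ball a 1) (_root_.measurableSet_ball.diff _root_.measurableSet_ball)
    ((measure_mono sdiff_subset).trans_lt (measure_ball_lt_top (μ := (volume : Measure E3)) (x := a') (r := 1)))
  calc ∫ z, |(ball a 1).indicator (1 : E3 → ℝ) z - (ball a' 1).indicator 1 z|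
      ≤ ∫ z, ((ball a 1 \ ball a' 1).indicator (1 : E3 → ℝ) z + (ball a' 1 \ ball a 1).indicator 1 z) := by
        refine integral_mono_of_nonneg (Eventually.of_forall fun z => abs_nonneg _) (hi1.add hi2)
          (Eventually.of_forall hpt)
    _ = volume.real (ball a 1 \ ball a' 1) + volume.real (ball a' 1 \ ball a 1) := by
        rw [integral_add hi1 hi2, integral_indicator_one (_root_.measurableSet_ball.diff _root_.measurableSet_ball),
          integral_indicator_one (_root_.measurableSet_ball.diff _root_.measurableSet_ball)]
    _ ≤ 3 * v₁ * d + 3 * v₁ * d := add_le_add (hshell a a' rfl) (hshell a' a (by rw [dist_comm]))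
    _ = 6 * v₁ * dist a a' := by rw [hdd]; ring

/-- **One hybrid step**: `|∫ (H_i − H_{i+1}) F| ≤ M v₁^{j−1} · 6 v₁ ‖a − a'‖` for `|F| ≤ M`. [folklore] -/
theorem abs_integral_hyb_sub_hyb_le {a a' : E3} (hd : dist a a' ≤ 1) {j i : ℕ} (hi : i < j)
    {F : (Fin j → E3) → ℝ} (hFm : Measurable F) {M : ℝ} (hF : ∀ y, |F y| ≤ M) :
    |∫ y, (hyb a a' j i y - hyb a a' j (i + 1) y) * F y| ≤ M * (v₁ ^ (j - 1) * (6 * v₁ * dist a a')) := by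
  have hv := v₁_pos
  have hM : 0 ≤ M := (abs_nonneg _).trans (hF fun _ => 0)
  set kᵢ : Fin j := ⟨i, hi⟩ with hkᵢ
  -- the common factors and the one-coordinate difference
  set g : Fin j → E3 → ℝ := fun k z =>
    if (k : ℕ) < i then (ball a' 1).indicator (1 : E3 → ℝ) z else (ball a 1).indicator 1 z with hg
  set δf : E3 → ℝ := fun z => (ball a 1).indicator (1 : E3 → ℝ) z - (ball a' 1).indicator 1 z with hδf
  have hfac : ∀ y : Fin j → E3, hyb a a' j i y - hyb a a' j (i + 1) y =
      δf (y kᵢ) * ∏ k ∈ Finset.univ.erase kᵢ, g k (y k) := by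
    intro y
    have e1 : hyb a a' j i y = (ball a 1).indicator (1 : E3 → ℝ) (y kᵢ) * ∏ k ∈ Finset.univ.erase kᵢ, g k (y k) := by
      rw [hyb, ← Finset.mul_prod_erase _ _ (Finset.mem_univ kᵢ)]
      congr 1
      · simp [hkᵢ]
    have e2 : hyb a a' j (i + 1) y = (ball a' 1).indicator (1 : E3 → ℝ) (y kᵢ) *
        ∏ k ∈ Finset.univ.erase kᵢ, g k (y k) := by
      rw [hyb, ← Finset.mul_prod_erase _ _ (Finset.mem_univ kᵢ)]
      congr 1
      · simp [hkᵢ]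
      · refine Finset.prod_congr rfl fun k hk => ?_
        have hne : (k : ℕ) ≠ i := fun e => (Finset.ne_of_mem_erase hk) (Fin.ext e)
        have : ((k : ℕ) < i + 1) ↔ ((k : ℕ) < i) := by omega
        simp only [hg, this]
    rw [e1, e2, hδf, sub_mul]
  -- the absolute hybrid difference is a product of one-coordinate functions
  set f : Fin j → E3 → ℝ := Function.update g kᵢ (fun z => |δf z|) with hf
  have hprod : ∀ y : Fin j → E3, |δf (y kᵢ)| * ∏ k ∈ Finset.univ.erase kᵢ, g k (y k) = ∏ k, f k (y k) := by
    intro y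
    rw [← Finset.mul_prod_erase _ _ (Finset.mem_univ kᵢ)]
    congr 1
    · simp [hf]
    · refine Finset.prod_congr rfl fun k hk => ?_
      rw [hf, Function.update_of_ne (Finset.ne_of_mem_erase hk)]
  have hg01 : ∀ k z, g k z ∈ Icc (0 : ℝ) 1 := by
    intro k z; simp only [hg]; split_ifs <;> exact indicator_ball_mem _ _
  have hgint : ∀ k, ∫ z, g k z = v₁ := by
    intro k; simp only [hg]; split_ifs <;> exact integral_indicator_ball _
  have hPnn : ∀ y : Fin j → E3, 0 ≤ ∏ k ∈ Finset.univ.erase kᵢ, g k (y k) := fun y =>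
    Finset.prod_nonneg fun k _ => (hg01 k _).1
  -- integrability
  have hmeas_ind : ∀ b : E3, Measurable fun z : E3 => (ball b 1).indicator (1 : E3 → ℝ) z := fun b =>
    measurable_one.indicator _root_.measurableSet_ball
  have hgm : ∀ k, Measurable (g k) := by
    intro k; simp only [hg]; split_ifs <;> exact hmeas_ind _
  have hδm : Measurable δf := (hmeas_ind a).sub (hmeas_ind a')
  have hHm : Measurable fun y : Fin j → E3 => δf (y kᵢ) * ∏ k ∈ Finset.univ.erase kᵢ, g k (y k) :=
    (hδm.comp (measurable_pi_apply kᵢ)).mul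
      (Finset.measurable_prod _ fun k _ => (hgm k).comp (measurable_pi_apply k))
  have hsupp : ∀ y : Fin j → E3, |δf (y kᵢ) * ∏ k ∈ Finset.univ.erase kᵢ, g k (y k)| ≤
      (Set.pi univ fun _ : Fin j => ball a 1 ∪ ball a' 1).indicator (fun _ => (1 : ℝ)) y := by
    intro y
    by_cases hy : y ∈ Set.pi univ fun _ : Fin j => ball a 1 ∪ ball a' 1
    · rw [indicator_of_mem hy, abs_mul, abs_of_nonneg (hPnn y)]
      have h1 : |δf (y kᵢ)| ≤ 1 := by
        simp only [hδf]
        have := indicator_ball_mem a (y kᵢ); have := indicator_ball_mem a' (y kᵢ)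
        rw [abs_le]; constructor <;> linarith [this.1, this.2, (indicator_ball_mem a (y kᵢ)).1,
          (indicator_ball_mem a (y kᵢ)).2]
      have h2 : ∏ k ∈ Finset.univ.erase kᵢ, g k (y k) ≤ 1 :=
        Finset.prod_le_one (fun k _ => (hg01 k _).1) fun k _ => (hg01 k _).2
      nlinarith [hPnn y, abs_nonneg (δf (y kᵢ))]
    · rw [indicator_of_notMem hy]
      simp only [mem_univ_pi, not_forall] at hy
      obtain ⟨k, hk⟩ := hy
      rw [mem_union, not_or, mem_ball, mem_ball, not_lt, not_lt] at hk
      have hz : ∀ b : E3, 1 ≤ dist (y k) b → (ball b 1).indicator (1 : E3 → ℝ) (y k) = 0 := fun b hb =>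
        indicator_of_notMem (by rw [mem_ball, not_lt]; exact hb) _
      by_cases hki : k = kᵢ
      · subst hki
        simp only [hδf, hz a hk.1, hz a' hk.2, sub_self, zero_mul, abs_zero, le_refl]
      · have : ∏ k ∈ Finset.univ.erase kᵢ, g k (y k) = 0 := by
          refine Finset.prod_eq_zero (Finset.mem_erase.2 ⟨hki, Finset.mem_univ k⟩) ?_
          simp only [hg]; split_ifs
          · exact hz a' hk.2
          · exact hz a hk.1
        rw [this, mul_zero, abs_zero]
  have hSfin : volume (Set.pi univ fun _ : Fin j => ball a 1 ∪ ball a' 1) < ∞ := by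
    rw [show (volume : Measure (Fin j → E3)) = Measure.pi fun _ => volume from volume_pi, Measure.pi_pi]
    exact ENNReal.prod_lt_top fun _ _ => measure_union_lt_top measure_ball_lt_top measure_ball_lt_top
  have hSm : MeasurableSet (Set.pi univ fun _ : Fin j => ball a 1 ∪ ball a' 1) :=
    MeasurableSet.univ_pi fun _ => _root_.measurableSet_ball.union _root_.measurableSet_ball
  have hdom : Integrable ((Set.pi univ fun _ : Fin j => ball a 1 ∪ ball a' 1).indicator fun _ => (M : ℝ)) :=
    (integrable_indicator_iff hSm).2 (integrableOn_const hSfin.ne)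
  have hintH : Integrable fun y : Fin j → E3 => |δf (y kᵢ) * ∏ k ∈ Finset.univ.erase kᵢ, g k (y k)| := by
    refine Integrable.mono' ((integrable_indicator_iff hSm).2 (integrableOn_const hSfin.ne (C := (1 : ℝ))))
      hHm.abs.aestronglyMeasurable (Eventually.of_forall fun y => ?_)
    rw [Real.norm_eq_abs, abs_abs]
    exact hsupp y
  have hintHF : Integrable fun y : Fin j → E3 =>
      (δf (y kᵢ) * ∏ k ∈ Finset.univ.erase kᵢ, g k (y k)) * F y := by
    refine Integrable.mono' hdom (hHm.mul hFm).aestronglyMeasurable (Eventually.of_forall fun y => ?_)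
    rw [Real.norm_eq_abs, abs_mul]
    calc |δf (y kᵢ) * ∏ k ∈ Finset.univ.erase kᵢ, g k (y k)| * |F y|
        ≤ (Set.pi univ fun _ : Fin j => ball a 1 ∪ ball a' 1).indicator (fun _ => (1 : ℝ)) y * M :=
          mul_le_mul (hsupp y) (hF y) (abs_nonneg _) (indicator_nonneg (fun _ _ => zero_le_one) _)
      _ = (Set.pi univ fun _ : Fin j => ball a 1 ∪ ball a' 1).indicator (fun _ => M) y := by
          simp only [indicator]; split_ifs <;> simp
  -- the estimate
  simp_rw [hfac]
  calc |∫ y : Fin j → E3, (δf (y kᵢ) * ∏ k ∈ Finset.univ.erase kᵢ, g k (y k)) * F y|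
      ≤ ∫ y : Fin j → E3, |(δf (y kᵢ) * ∏ k ∈ Finset.univ.erase kᵢ, g k (y k)) * F y| :=
        abs_integral_le_integral_abs
    _ ≤ ∫ y : Fin j → E3, |δf (y kᵢ) * ∏ k ∈ Finset.univ.erase kᵢ, g k (y k)| * M := by
        refine integral_mono_of_nonneg (Eventually.of_forall fun y => abs_nonneg _) (hintH.mul_const M)
          (Eventually.of_forall fun y => ?_)
        dsimp only
        rw [abs_mul]
        exact mul_le_mul_of_nonneg_left (hF y) (abs_nonneg _)
    _ = (∫ y : Fin j → E3, ∏ k, f k (y k)) * M := by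
        rw [integral_mul_const]
        congr 1
        refine integral_congr_ae (ae_of_all _ fun y => ?_)
        dsimp only
        rw [abs_mul, abs_of_nonneg (hPnn y), hprod]
    _ = (∏ k, ∫ z, f k z) * M := by
        rw [show (volume : Measure (Fin j → E3)) = Measure.pi fun _ => volume from volume_pi,
          integral_fintype_prod_eq_prod]
    _ ≤ (6 * v₁ * dist a a' * v₁ ^ (j - 1)) * M := by
        refine mul_le_mul_of_nonneg_right ?_ hM
        rw [← Finset.mul_prod_erase _ _ (Finset.mem_univ kᵢ)]
        have e1 : ∫ z, f kᵢ z = ∫ z, |δf z| := by simp [hf]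
        have e2 : ∏ k ∈ Finset.univ.erase kᵢ, ∫ z, f k z = v₁ ^ (j - 1) := by
          rw [Finset.prod_congr rfl (fun k hk => by rw [hf, Function.update_of_ne (Finset.ne_of_mem_erase hk), hgint]),
            Finset.prod_const, Finset.card_erase_of_mem (Finset.mem_univ _), Finset.card_univ, Fintype.card_fin]
        rw [e1, e2]
        exact mul_le_mul_of_nonneg_right (integral_abs_indicator_sub_le hd) (by positivity)
    _ = M * (v₁ ^ (j - 1) * (6 * v₁ * dist a a')) := by ring

/-- **The product-ball integral is Lipschitz in the centre**: for `|F| ≤ M` measurable,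
`|∫ (ballProd a − ballProd a') F| ≤ j M v₁^{j−1} · 6 v₁ ‖a − a'‖`. [folklore] -/
theorem abs_integral_ballProd_sub_le {a a' : E3} (hd : dist a a' ≤ 1) {j : ℕ} {F : (Fin j → E3) → ℝ}
    (hFm : Measurable F) {M : ℝ} (hF : ∀ y, |F y| ≤ M) :
    |∫ y, (HardSphereKS.ballProd a y - HardSphereKS.ballProd a' y) * F y| ≤
      j * (M * (v₁ ^ (j - 1) * (6 * v₁ * dist a a'))) := by
  have hM : 0 ≤ M := (abs_nonneg _).trans (hF fun _ => 0)
  -- integrability of every hybrid term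
  have hint : ∀ i, Integrable fun y : Fin j → E3 => hyb a a' j i y * F y := by
    intro i
    have hHm : Measurable (hyb a a' j i) :=
      Finset.measurable_prod _ fun k _ => Measurable.ite (measurableSet_lt measurable_const measurable_const)
        ((measurable_one.indicator _root_.measurableSet_ball).comp (measurable_pi_apply k))
        ((measurable_one.indicator _root_.measurableSet_ball).comp (measurable_pi_apply k))
    have hSm : MeasurableSet (Set.pi univ fun _ : Fin j => ball a 1 ∪ ball a' 1) :=
      MeasurableSet.univ_pi fun _ => _root_.measurableSet_ball.union _root_.measurableSet_ball
    have hSfin : volume (Set.pi univ fun _ : Fin j => ball a 1 ∪ ball a' 1) < ∞ := by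
      rw [show (volume : Measure (Fin j → E3)) = Measure.pi fun _ => volume from volume_pi, Measure.pi_pi]
      exact ENNReal.prod_lt_top fun _ _ => measure_union_lt_top measure_ball_lt_top measure_ball_lt_top
    refine Integrable.mono' ((integrable_indicator_iff hSm).2 (integrableOn_const hSfin.ne (C := M)))
      (hHm.mul hFm).aestronglyMeasurable (Eventually.of_forall fun y => ?_)
    rw [Real.norm_eq_abs, abs_mul]
    by_cases hy : y ∈ Set.pi univ fun _ : Fin j => ball a 1 ∪ ball a' 1
    · rw [indicator_of_mem hy]
      have h1 : |hyb a a' j i y| ≤ 1 := by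
        rw [hyb, abs_of_nonneg (Finset.prod_nonneg fun k _ => by split_ifs <;> exact (indicator_ball_mem _ _).1)]
        exact Finset.prod_le_one (fun k _ => by split_ifs <;> exact (indicator_ball_mem _ _).1)
          fun k _ => by split_ifs <;> exact (indicator_ball_mem _ _).2
      nlinarith [hF y, abs_nonneg (F y), abs_nonneg (hyb a a' j i y)]
    · rw [indicator_of_notMem hy]
      simp only [mem_univ_pi, not_forall] at hy
      obtain ⟨k, hk⟩ := hy
      rw [mem_union, not_or] at hk
      have : hyb a a' j i y = 0 := by
        refine Finset.prod_eq_zero (Finset.mem_univ k) ?_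
        split_ifs
        · exact indicator_of_notMem hk.2 _
        · exact indicator_of_notMem hk.1 _
      rw [this, abs_zero, zero_mul]
  -- telescoping
  have htel : ∀ y, (HardSphereKS.ballProd a y - HardSphereKS.ballProd a' y) * F y =
      ∑ i ∈ Finset.range j, (hyb a a' j i y - hyb a a' j (i + 1) y) * F y := by
    intro y
    rw [← Finset.sum_mul, Finset.sum_range_sub', hyb_zero, hyb_self]
  simp_rw [htel]
  rw [integral_finsetSum _ fun i _ => by simp_rw [sub_mul]; exact (hint i).sub (hint (i + 1))]
  calc |∑ i ∈ Finset.range j, ∫ y, (hyb a a' j i y - hyb a a' j (i + 1) y) * F y|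
      ≤ ∑ i ∈ Finset.range j, |∫ y, (hyb a a' j i y - hyb a a' j (i + 1) y) * F y| := Finset.abs_sum_le_sum_abs _ _
    _ ≤ ∑ i ∈ Finset.range j, M * (v₁ ^ (j - 1) * (6 * v₁ * dist a a')) :=
        Finset.sum_le_sum fun i hi => abs_integral_hyb_sub_hyb_le hd (Finset.mem_range.1 hi) hFm hF
    _ = j * (M * (v₁ ^ (j - 1) * (6 * v₁ * dist a a'))) := by rw [Finset.sum_const, Finset.card_range, nsmul_eq_mul]

section LipG

variable {σ : ℝ} (h : SmallDensity uniformProfile σ)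
include h

omit h in
/-- `Fin.tail (q, p) = (p)`. [folklore] -/
theorem tail_vec2 (q p : E3) : Fin.tail (![q, p] : Fin 2 → E3) = ![p] := by
  funext i; simp [Fin.tail]

omit h in
/-- The hard wall factor at `(q, 0)` is `1` outside contact. [folklore] -/
theorem wall_vec2 {q : E3} (hq : 1 ≤ ‖q‖) : HardSphereKS.wall (![q, 0] : Fin 2 → E3) = 1 := by
  unfold HardSphereKS.wall
  rw [if_pos]
  intro i
  fin_cases i
  simpa [dist_eq_norm] using hq

/-- The termwise Lipschitz bound of the Kirkwood–Salsburg series of `g₂(·, 0)`. [folklore] -/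
theorem norm_ksTerm_two_sub_le {q q' : E3} (hd : dist q q' ≤ 1) (j : ℕ) :
    ‖HardSphereKS.ksTerm (σ ^ 3) (gLim σ) 1 j ![q, 0] - HardSphereKS.ksTerm (σ ^ 3) (gLim σ) 1 j ![q', 0]‖ ≤
      18 * dist q q' * 6 ^ 0 * ((|σ ^ 3| * HardSphereKS.v1 E3 * 6) ^ j / (Nat.factorial j : ℝ)) := by
  have hv : 0 < v₁ := v₁_pos
  have hρ : 0 < σ ^ 3 := pow_pos h.σ_pos 3
  have hd0 : 0 ≤ dist q q' := dist_nonneg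
  set G : (Fin j → E3) → ℝ := fun ζ => gLim σ (1 + j) (Fin.append ![(0 : E3)] ζ) with hG
  have hGm : Measurable G := (measurable_gLim h _).comp (HardSphereKS.continuous_append_right _).measurable
  have hGb : ∀ ζ, |G ζ| ≤ 3 ^ (1 + j) := fun ζ => abs_gLim_le h _ _
  have hint : ∀ r : E3, Integrable fun ζ : Fin j → E3 => HardSphereKS.ballProd r ζ * G ζ := by
    intro r
    have := HardSphereKS.integrable_ksIntegrand (measurable_gLim h) (m := 1) (n := j)
      (fun y => abs_gLim_le h (1 + j) y) ![r, 0]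
    simpa [HardSphereKS.ksIntegrand, tail_vec2] using this
  have e : HardSphereKS.ksTerm (σ ^ 3) (gLim σ) 1 j ![q, 0] - HardSphereKS.ksTerm (σ ^ 3) (gLim σ) 1 j ![q', 0] =
      (-(σ ^ 3)) ^ j / (Nat.factorial j : ℝ) *
        ∫ ζ : Fin j → E3, (HardSphereKS.ballProd q ζ - HardSphereKS.ballProd q' ζ) * G ζ := by
    simp only [HardSphereKS.ksTerm, HardSphereKS.ksIntegrand, Matrix.cons_val_zero, tail_vec2, hG]
    rw [← mul_sub, ← integral_sub (hint q) (hint q')]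
    congr 1
    refine integral_congr_ae (ae_of_all _ fun ζ => ?_)
    ring
  rw [e, Real.norm_eq_abs, abs_mul, abs_div, abs_pow, abs_neg, Nat.abs_cast, v1_E3_eq, abs_of_pos hρ]
  have hI := abs_integral_ballProd_sub_le hd hGm hGb
  calc (σ ^ 3) ^ j / (Nat.factorial j : ℝ) *
        |∫ ζ : Fin j → E3, (HardSphereKS.ballProd q ζ - HardSphereKS.ballProd q' ζ) * G ζ|
      ≤ (σ ^ 3) ^ j / (Nat.factorial j : ℝ) * (j * (3 ^ (1 + j) * (v₁ ^ (j - 1) * (6 * v₁ * dist q q')))) :=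
        mul_le_mul_of_nonneg_left hI (by positivity)
    _ ≤ 18 * dist q q' * 6 ^ 0 * ((σ ^ 3 * v₁ * 6) ^ j / (Nat.factorial j : ℝ)) := by
        cases j with
        | zero => simp
        | succ j =>
          simp only [Nat.add_sub_cancel]
          set A := 18 * dist q q' * (σ ^ 3 * v₁) ^ (j + 1) / (Nat.factorial (j + 1) : ℝ) with hA
          have hA0 : 0 ≤ A := by positivity
          have key : ((j + 1 : ℕ) : ℝ) * 3 ^ (j + 1) ≤ 6 ^ (j + 1) := by
            have h2 : ((j + 1 : ℕ) : ℝ) ≤ 2 ^ (j + 1) := by exact_mod_cast (Nat.lt_two_pow_self).le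
            calc ((j + 1 : ℕ) : ℝ) * 3 ^ (j + 1) ≤ 2 ^ (j + 1) * 3 ^ (j + 1) :=
                  mul_le_mul_of_nonneg_right h2 (by positivity)
              _ = 6 ^ (j + 1) := by rw [← mul_pow]; norm_num
          calc (σ ^ 3) ^ (j + 1) / (Nat.factorial (j + 1) : ℝ) *
                (((j + 1 : ℕ) : ℝ) * (3 ^ (1 + (j + 1)) * (v₁ ^ j * (6 * v₁ * dist q q'))))
              = A * (((j + 1 : ℕ) : ℝ) * 3 ^ (j + 1)) := by rw [hA]; ring
            _ ≤ A * 6 ^ (j + 1) := mul_le_mul_of_nonneg_left key hA0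
            _ = 18 * dist q q' * 6 ^ 0 * ((σ ^ 3 * v₁ * 6) ^ (j + 1) / (Nat.factorial (j + 1) : ℝ)) := by
                rw [hA]; ring

/-- **`q ↦ g₂(q, 0)` is Lipschitz outside contact**:
`|g₂(q,0) − g₂(q',0)| ≤ 36 e^{6 σ³ v₁} ‖q − q'‖` for `‖q‖, ‖q'‖ ≥ 1`, `‖q − q'‖ ≤ 1`
(the Kirkwood–Salsburg equation at order `2` and the `L¹`-continuity of translated product balls).
[cite: Ruelle1969, §4.2.2] -/
theorem abs_gLim_two_sub_le {q q' : E3} (hq : 1 ≤ ‖q‖) (hq' : 1 ≤ ‖q'‖) (hd : dist q q' ≤ 1) :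
    |gLim σ 2 ![q, 0] - gLim σ 2 ![q', 0]| ≤ 36 * Real.exp (σ ^ 3 * v₁ * 6) * dist q q' := by
  have hρ : 0 < σ ^ 3 := pow_pos h.σ_pos 3
  rw [gLim_succ h 1 ![q, 0], gLim_succ h 1 ![q', 0], wall_vec2 hq, wall_vec2 hq', mul_one, ← mul_sub, abs_mul,
    abs_of_pos h.ratioLimit_pos]
  have hs := summable_ksTerm_gLim h 1 ![q, 0]
  have hs' := summable_ksTerm_gLim h 1 ![q', 0]
  rw [← hs.tsum_sub hs']
  have hmaj := HardSphereKS.hasSum_majorant (E := E3) (σ ^ 3) 6 (18 * dist q q') 0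
  have hb := tsum_of_norm_bounded hmaj (norm_ksTerm_two_sub_le h hd)
  rw [Real.norm_eq_abs, v1_E3_eq, abs_of_pos hρ, pow_zero, mul_one] at hb
  have hR := h.ratioLimit_mem.2
  calc ratioLimit uniformProfile σ * |∑' b, (HardSphereKS.ksTerm (σ ^ 3) (gLim σ) 1 b ![q, 0] -
        HardSphereKS.ksTerm (σ ^ 3) (gLim σ) 1 b ![q', 0])|
      ≤ 2 * (18 * dist q q' * Real.exp (σ ^ 3 * v₁ * 6)) :=
        mul_le_mul hR hb (abs_nonneg _) (by norm_num)
    _ = 36 * Real.exp (σ ^ 3 * v₁ * 6) * dist q q' := by ring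

/-- **Near contact, `g₂(q, 0)` is close to the contact value**:
`|g₂(q,0) − g₂(1⁺)| ≤ 36 e^{6σ³v₁} (‖q‖ − 1)` for `1 ≤ ‖q‖ ≤ 2`. [folklore] -/
theorem abs_gLim_two_sub_contactG_le {q : E3} (hq : 1 ≤ ‖q‖) (hq2 : ‖q‖ ≤ 2) :
    |gLim σ 2 ![q, 0] - contactG σ| ≤ 36 * Real.exp (σ ^ 3 * v₁ * 6) * (‖q‖ - 1) := by
  have hn : ‖q‖ ≠ 0 := by linarith
  set q' : E3 := ‖q‖⁻¹ • q with hq'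
  have hnq' : ‖q'‖ = 1 := by rw [hq', norm_smul, norm_inv, norm_norm, inv_mul_cancel₀ hn]
  have hdist : dist q q' = ‖q‖ - 1 := by
    have e : q - q' = (1 - ‖q‖⁻¹) • q := by rw [hq', sub_smul, one_smul]
    rw [dist_eq_norm, e, norm_smul, Real.norm_eq_abs, abs_of_nonneg (sub_nonneg.2 (inv_le_one_of_one_le₀ hq)),
      sub_mul, one_mul, inv_mul_cancel₀ hn]
  rw [← gLim_two_eq_contactG h hnq', ← hdist]
  exact abs_gLim_two_sub_le h hq (by rw [hnq']) (by rw [hdist]; linarith)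

end LipG

/-! ### The finite-`N` excess free energy and its derivative in the density -/

section FreeEnergy

/-- The hard-sphere diameter on the unit torus at reduced density `t` with `N` particles:
`(t/N)^{1/3}` (the normalisation of `hsFreeVolume`). [folklore] -/
def diam (t : ℝ) (N : ℕ) : ℝ := (t / N) ^ (1 / 3 : ℝ)

/-- `0 < (t/N)^{1/3}`. [folklore] -/
theorem diam_pos {t : ℝ} (ht : 0 < t) {N : ℕ} (hN : 0 < N) : 0 < diam t N :=
  Real.rpow_pos_of_pos (div_pos ht (Nat.cast_pos.2 hN)) _

/-- `((t/N)^{1/3})³ = t/N`. [folklore] -/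
theorem diam_pow_three {t : ℝ} (ht : 0 ≤ t) (N : ℕ) : diam t N ^ 3 = t / N := by
  rw [diam, ← Real.rpow_natCast, ← Real.rpow_mul (div_nonneg ht (Nat.cast_nonneg _))]; norm_num

/-- `(σ³)^{1/3} = σ`. [folklore] -/
theorem pow_three_rpow_third {σ : ℝ} (hσ : 0 ≤ σ) : (σ ^ 3) ^ (1 / 3 : ℝ) = σ := by
  rw [← Real.rpow_natCast, ← Real.rpow_mul hσ]; norm_num

/-- `(t^{1/3})³ = t`. [folklore] -/
theorem rpow_third_pow_three {t : ℝ} (ht : 0 ≤ t) : (t ^ (1 / 3 : ℝ)) ^ 3 = t := by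
  rw [← Real.rpow_natCast, ← Real.rpow_mul ht]; norm_num

/-- **The two diameter normalisations agree**: `(t/(m+2))^{1/3} = hsDiameter t^{1/3} (m+1)`. [folklore] -/
theorem diam_eq_hsDiameter {t : ℝ} (ht : 0 ≤ t) (m : ℕ) : diam t (m + 2) = hsDiameter (t ^ (1 / 3 : ℝ)) (m + 1) := by
  rw [diam, hsDiameter, Real.div_rpow ht (Nat.cast_nonneg _), Real.rpow_neg (Nat.cast_nonneg _), div_eq_mul_inv]

/-- `(t/(m+2))^{1/3} ≤ t^{1/3}`. [folklore] -/
theorem diam_le {t : ℝ} (ht : 0 ≤ t) (m : ℕ) : diam t (m + 2) ≤ t ^ (1 / 3 : ℝ) := by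
  rw [diam_eq_hsDiameter ht]; exact hsDiameter_le (Real.rpow_nonneg ht _) _

/-- **The free volume is the hard-core measure**: the strict and the non-strict exclusion differ by
the null contact set. [folklore] -/
theorem hsFreeVolume_eq_XiT {t : ℝ} (ht : 0 < t) {N : ℕ} (hN : 0 < N) : hsFreeVolume t N = XiT (diam t N) N := by
  rw [hsFreeVolume, XiT_eq_measureReal_hcSet, measureReal_def]
  have he : diam t N ≠ 0 := (diam_pos ht hN).ne'
  set S : Set (Fin N → T3) := {q | ∀ i j, i ≠ j → (t / N) ^ (1 / 3 : ℝ) < Torus.euclidDist (q i) (q j)} with hS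
  congr 1
  refine le_antisymm (measure_mono fun q hq i j hij => ?_) ?_
  · exact not_lt.2 (hq i j hij).le
  · set Z : Set (Fin N → T3) := ⋃ i : Fin N, ⋃ j : Fin N, {q | i ≠ j ∧ Torus.euclidDist (q i) (q j) = diam t N}
      with hZ
    have hZ0 : volume Z = 0 := by
      refine measure_iUnion_null fun i => measure_iUnion_null fun j => ?_
      by_cases hij : i = j
      · have : {q : Fin N → T3 | i ≠ j ∧ Torus.euclidDist (q i) (q j) = diam t N} = ∅ := by
          ext q; simp [hij]
        rw [this, measure_empty]
      · have hT : MeasurableSet {z : T3 | Torus.euclidDist z 0 = diam t N} := by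
          have : Measurable fun z : T3 => Torus.euclidDist z 0 :=
            (Torus.continuous_norm_reprSym.comp (continuous_id.sub continuous_const)).measurable
          exact this (measurableSet_singleton _)
        have e1 : {q : Fin N → T3 | i ≠ j ∧ Torus.euclidDist (q i) (q j) = diam t N} =
            {q | q i - q j ∈ {z : T3 | Torus.euclidDist z 0 = diam t N}} := by
          ext q; simp [hij, Torus.euclidDist_eq]
        rw [e1, show (volume : Measure (Fin N → T3)) = Measure.pi fun _ => volume from volume_pi,
          pi_pairEvent_eq hij hT]
        exact Torus.volume_euclidDist_eq he 0
    calc volume (hcSet (diam t N) N) ≤ volume (S ∪ Z) := by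
          refine measure_mono fun q hq => ?_
          by_cases hS' : q ∈ S
          · exact Or.inl hS'
          · right
            simp only [hS, mem_setOf_eq, not_forall, not_lt] at hS'
            obtain ⟨i, j, hij, hle⟩ := hS'
            have hge : diam t N ≤ Torus.euclidDist (q i) (q j) := not_lt.1 (hq i j hij)
            rw [hZ]; simp only [mem_iUnion, mem_setOf_eq]
            exact ⟨i, j, hij, le_antisymm hle hge⟩
      _ ≤ volume S + volume Z := measure_union_le _ _
      _ = volume S := by rw [hZ0, add_zero]

/-- The finite-`N` excess free energy per particle `f_N(t) = −N⁻¹ log Ξ_{(t/N)^{1/3}}(N)`.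
[cite: Ruelle1969, §3.4.3] -/
def fN (N : ℕ) (t : ℝ) : ℝ := -(N : ℝ)⁻¹ * Real.log (XiT (diam t N) N)

/-- `f_ex(t) = limsup_m f_{m+2}(t)`. [folklore] -/
theorem hsExcessFreeEnergy_eq_limsup {t : ℝ} (ht : 0 < t) :
    hsExcessFreeEnergy t = limsup (fun m : ℕ => fN (m + 2) t) atTop := by
  rw [hsExcessFreeEnergy, ← Filter.limsup_nat_add _ 2]
  refine limsup_congr (Eventually.of_forall fun m => ?_)
  rw [fN, hsFreeVolume_eq_XiT ht (by omega)]

/-- `d/dt (t/N)^{1/3} = (t/N)^{1/3}/(3t)`. [folklore] -/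
theorem hasDerivAt_diam {t : ℝ} (ht : 0 < t) {N : ℕ} (hN : 0 < N) :
    HasDerivAt (fun t => diam t N) (diam t N / (3 * t)) t := by
  have hN' : (0 : ℝ) < N := Nat.cast_pos.2 hN
  have htN : t / N ≠ 0 := (div_pos ht hN').ne'
  have h1 : HasDerivAt (fun t : ℝ => t / N) (1 / N) t := by
    simpa using (hasDerivAt_id t).div_const (N : ℝ)
  have h2 := (Real.hasDerivAt_rpow_const (p := (1 / 3 : ℝ)) (Or.inl htN)).comp t h1
  have e : (1 / 3 : ℝ) * (t / N) ^ ((1 / 3 : ℝ) - 1) * (1 / N) = diam t N / (3 * t) := by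
    rw [Real.rpow_sub_one htN, diam]
    field_simp
  rw [← e]
  exact h2

/-- The right derivative of `f_{m+2}`: `((m+1)/(2(m+2))) v₁ ⟨u⟩_contact / Ξ`. [folklore] -/
def derivFN (m : ℕ) (t : ℝ) : ℝ :=
  ((m + 1 : ℝ) / (2 * (m + 2))) * v₁ * (contactAvg (diam t (m + 2)) m / XiT (diam t (m + 2)) (m + 2))

/-- **The derivative of the finite-`N` free energy in the density** (chain rule on the virial identity
`hasDerivWithinAt_XiT`): `f_{m+2}` has right derivative `derivFN m t` at `t`. [cite: HansenMcdonald2013, §2.5 (2.5.22)] -/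
theorem hasDerivWithinAt_fN {t : ℝ} (ht : 0 < t) {m : ℕ} (h4 : diam t (m + 2) < 1 / 4)
    (hX : 0 < XiT (diam t (m + 2)) (m + 2)) : HasDerivWithinAt (fN (m + 2)) (derivFN m t) (Ioi t) t := by
  have hv : 0 < v₁ := v₁_pos
  have hm : (0 : ℕ) < m + 2 := by omega
  have he : 0 < diam t (m + 2) := diam_pos ht hm
  have hD := hasDerivWithinAt_XiT he h4 m
  have hd := (hasDerivAt_diam ht hm).hasDerivWithinAt (s := Ioi t)
  have hmaps : MapsTo (fun t => diam t (m + 2)) (Ioi t) (Ioi (diam t (m + 2))) := by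
    intro t' ht'
    rw [mem_Ioi] at ht'
    show diam t (m + 2) < diam t' (m + 2)
    simp only [diam]
    have hN : (0 : ℝ) < (m + 2 : ℕ) := Nat.cast_pos.2 hm
    exact Real.rpow_lt_rpow (div_nonneg ht.le hN.le) (div_lt_div_of_pos_right ht' hN) (by norm_num)
  have hcomp := hD.comp t hd hmaps
  have hlog := hcomp.log hX.ne'
  have hfin := hlog.const_mul (-((m + 2 : ℕ) : ℝ)⁻¹)
  refine (show HasDerivWithinAt (fN (m + 2)) _ (Ioi t) t from hfin).congr_deriv ?_
  have e3 := diam_pow_three ht.le (m + 2)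
  have hM : (0 : ℝ) < ((m + 2 : ℕ) : ℝ) := Nat.cast_pos.2 hm
  have hX0 := hX.ne'
  simp only [Function.comp_def, derivFN, Nat.cast_choose_two]
  generalize hE : diam t (m + 2) = e at *
  have ht' : t = ((m + 2 : ℕ) : ℝ) * e ^ 3 := by rw [e3]; field_simp
  subst ht'
  have he0 : e ≠ 0 := he.ne'
  push_cast at hX0 hM ⊢
  field_simp
  ring

end FreeEnergy

/-! ### The limit of the finite-`N` derivative: `f_N' → (v₁/2) g₂(1⁺)` -/

/-- `v₁ = vol B(0,1)` as a `Measure.real`. [folklore] -/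
theorem measureReal_unitBall : (volume : Measure E3).real (ball 0 1) = v₁ := by
  rw [measureReal_def, v₁]

/-- **`v₁ = 4π/3`.** [folklore] -/
theorem v₁_eq : v₁ = 4 * Real.pi / 3 := by
  rw [v₁, EuclideanSpace.volume_ball_fin_three, ENNReal.toReal_mul, ← ENNReal.ofReal_pow zero_le_one,
    ENNReal.toReal_ofReal (by positivity), ENNReal.toReal_ofReal (by positivity)]
  ring

/-- The direction configuration `(proj(e û), 0)`, `û = u/‖u‖`. [folklore] -/
def Ydir (e : ℝ) (u : E3) : Fin 2 → T3 := ![Torus.proj (e • ‖u‖⁻¹ • u), 0]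

/-- `Ydir e` is measurable. [folklore] -/
theorem measurable_Ydir (e : ℝ) : Measurable (Ydir e) :=
  measurable_vec2.comp (Torus.measurable_proj.comp ((measurable_norm.inv.smul measurable_id).const_smul e))

/-- `contactDir e m u = u_e((proj(eû), 0))`. [folklore] -/
theorem contactDir_eq (e : ℝ) (m : ℕ) (u : E3) : contactDir e m u = pinnedXi e (Ydir e u) m := rfl

/-- `v_{m+2}(Ydir) = contactDir / Ξ`. [folklore] -/
theorem vcan_Ydir (e : ℝ) (m : ℕ) (u : E3) : vcan e (m + 2) (Ydir e u) = contactDir e m u / XiT e (m + 2) := by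
  rw [vcan, contactDir_eq, Nat.add_sub_cancel]

/-- The window of `Ydir`: both points are within `2e > e` of the origin (`0 < e < 1/4`). [folklore] -/
theorem euclidDist_Ydir_lt {e : ℝ} (he : 0 < e) (he4 : e < 1 / 4) {u : E3} (hu : u ≠ 0) (a : Fin 2) :
    Torus.euclidDist (Ydir e u a) 0 < 2 * e := by
  have hn : ‖e • ‖u‖⁻¹ • u‖ = e := by
    rw [norm_smul, norm_smul, norm_inv, norm_norm, inv_mul_cancel₀ (norm_ne_zero_iff.2 hu), mul_one,
      Real.norm_eq_abs, abs_of_pos he]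
  refine Fin.cases ?_ (fun j => ?_) a
  · show Torus.euclidDist (Torus.proj (e • ‖u‖⁻¹ • u)) 0 < 2 * e
    rw [euclidDist_proj_zero (by rw [hn]; linarith), hn]; linarith
  · fin_cases j
    show Torus.euclidDist (0 : T3) 0 < 2 * e
    rw [Torus.euclidDist_self]; linarith

/-- The lift of `Ydir` at the origin is `(û, 0)`. [folklore] -/
theorem liftAt_Ydir {e : ℝ} (he : 0 < e) (he4 : e < 1 / 4) {u : E3} (hu : u ≠ 0) :
    liftAt e 0 (Ydir e u) = ![‖u‖⁻¹ • u, 0] := by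
  have hn : ‖e • ‖u‖⁻¹ • u‖ = e := by
    rw [norm_smul, norm_smul, norm_inv, norm_norm, inv_mul_cancel₀ (norm_ne_zero_iff.2 hu), mul_one,
      Real.norm_eq_abs, abs_of_pos he]
  funext a
  refine Fin.cases ?_ (fun j => ?_) a
  · show e⁻¹ • Torus.reprSym (Torus.proj (e • ‖u‖⁻¹ • u) - 0) = ‖u‖⁻¹ • u
    rw [sub_zero, reprSym_proj_of_norm_lt (by rw [hn]; linarith), smul_smul, inv_mul_cancel₀ he.ne', one_smul]
  · fin_cases j
    show e⁻¹ • Torus.reprSym ((0 : T3) - 0) = 0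
    rw [sub_zero, Torus.reprSym_zero, smul_zero]

/-- Almost every `u` is nonzero. [folklore] -/
theorem ae_ne_zero : ∀ᵐ u ∂(volume : Measure E3), u ≠ 0 := by
  have : (volume : Measure E3) {u | ¬u ≠ 0} = 0 := by
    simp only [not_not, setOf_eq_eq_singleton, measure_singleton]
  exact this

section DerivLimit

variable {t : ℝ} (ht : 0 < t) (h : SmallDensity uniformProfile (t ^ (1 / 3 : ℝ)))
include ht h

/-- `Ξ > 0` along the diagonal `(t, m)`. [folklore] -/
theorem XiT_diam_pos (m : ℕ) : 0 < XiT (diam t (m + 2)) (m + 2) := by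
  rw [diam_eq_hsDiameter ht.le]; exact XiT_pos h (by omega)

/-- `u_e(contact) ≤ 4 Ξ` (the canonical pair correlation is `≤ 4`). [folklore] -/
theorem contactDir_le (m : ℕ) (u : E3) : contactDir (diam t (m + 2)) m u ≤ 4 * XiT (diam t (m + 2)) (m + 2) := by
  have hX := XiT_diam_pos ht h m
  have := vcan_le_two_pow' h (N := m + 1) (n := m + 2) (by omega) (Ydir (diam t (m + 2)) u)
  rw [← diam_eq_hsDiameter ht.le, vcan_Ydir, div_le_iff₀ hX] at this
  linarith [this]

omit ht h in
/-- `contactDir` is integrable on the unit ball. [folklore] -/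
theorem integrableOn_contactDir (e : ℝ) (m : ℕ) : IntegrableOn (contactDir e m) (ball (0 : E3) 1) :=
  Measure.integrableOn_of_bounded (M := 1) (measure_ball_lt_top (μ := (volume : Measure E3))).ne
    (measurable_contactDir e m).aestronglyMeasurable
    (ae_of_all _ fun u => by
      rw [Real.norm_eq_abs, abs_of_nonneg (contactDir_mem_Icc e m u).1]; exact (contactDir_mem_Icc e m u).2)

/-- **Uniform bound on the finite-`N` derivative**: `0 ≤ f_N'(t) ≤ 2 v₁`. [folklore] -/
theorem derivFN_mem_Icc (m : ℕ) : derivFN m t ∈ Icc (0 : ℝ) (2 * v₁) := by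
  have hv := v₁_pos
  have hX := XiT_diam_pos ht h m
  have hA0 := (contactAvg_mem_Icc (diam t (m + 2)) m).1
  have hratio : contactAvg (diam t (m + 2)) m / XiT (diam t (m + 2)) (m + 2) ≤ 4 := by
    rw [div_le_iff₀ hX, contactAvg]
    have hint : ∫ u in ball (0 : E3) 1, contactDir (diam t (m + 2)) m u ≤
        ∫ _ in ball (0 : E3) 1, 4 * XiT (diam t (m + 2)) (m + 2) :=
      setIntegral_mono_on (integrableOn_contactDir _ _) (integrableOn_const measure_ball_lt_top.ne)
        _root_.measurableSet_ball fun u _ => contactDir_le ht h m u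
    rw [setIntegral_const, measureReal_unitBall, smul_eq_mul] at hint
    calc v₁⁻¹ * (∫ u in ball (0 : E3) 1, contactDir (diam t (m + 2)) m u)
        ≤ v₁⁻¹ * (v₁ * (4 * XiT (diam t (m + 2)) (m + 2))) := mul_le_mul_of_nonneg_left hint (by positivity)
      _ = 4 * XiT (diam t (m + 2)) (m + 2) := by field_simp
  have hr0 : 0 ≤ contactAvg (diam t (m + 2)) m / XiT (diam t (m + 2)) (m + 2) := div_nonneg hA0 hX.le
  have hc : (m + 1 : ℝ) / (2 * (m + 2)) ≤ 1 / 2 := by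
    rw [div_le_iff₀ (by positivity)]; linarith
  have hc0 : 0 ≤ (m + 1 : ℝ) / (2 * (m + 2)) := by positivity
  refine ⟨by unfold derivFN; positivity, ?_⟩
  unfold derivFN
  calc (m + 1 : ℝ) / (2 * (m + 2)) * v₁ * (contactAvg (diam t (m + 2)) m / XiT (diam t (m + 2)) (m + 2))
      ≤ 1 / 2 * v₁ * 4 := by gcongr
    _ = 2 * v₁ := by ring

/-- **The contact ratio converges to the infinite-volume contact value**:
`⟨u⟩_contact / Ξ → g₂(1⁺)` as `m → ∞` (thermodynamic limit at contact scale + isotropy).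
[cite: PulvirentiTsagkarogiannis2012, Thm 2] -/
theorem tendsto_contactAvg_div (h4 : t ^ (1 / 3 : ℝ) < 1 / 4) :
    Tendsto (fun m : ℕ => contactAvg (diam t (m + 2)) m / XiT (diam t (m + 2)) (m + 2)) atTop
      (𝓝 (contactG (t ^ (1 / 3 : ℝ)))) := by
  have hv := v₁_pos
  set σ := t ^ (1 / 3 : ℝ) with hσ
  rw [Metric.tendsto_atTop]
  intro ε hε
  have hδ : (0 : ℝ) < ε / 32 := by positivity
  have hev := (ksInv_eventually h 2 hδ)
  have hev' := (tendsto_add_atTop_nat 1).eventually hev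
  obtain ⟨M, hM⟩ := eventually_atTop.1 hev'
  refine ⟨M, fun m hm => ?_⟩
  have hK : KSInv σ (m + 1) (m + 2) (2 * hsDiameter σ (m + 1)) (ε / 32) := hM m hm
  set e := diam t (m + 2) with hed
  have hee : e = hsDiameter σ (m + 1) := diam_eq_hsDiameter ht.le m
  have he : 0 < e := diam_pos ht (by omega)
  have he4 : e < 1 / 4 := (diam_le ht.le m).trans_lt h4
  have hX := XiT_diam_pos ht h m
  -- pointwise: `|v(Ydir u) − g₂(1⁺)| ≤ 16 δ` for `u ≠ 0`
  have hpt : ∀ u : E3, u ≠ 0 → |vcan e (m + 2) (Ydir e u) - contactG σ| ≤ ε / 32 * 4 ^ 2 := by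
    intro u hu
    have hunit : ‖‖u‖⁻¹ • u‖ = 1 := by
      rw [norm_smul, norm_inv, norm_norm, inv_mul_cancel₀ (norm_ne_zero_iff.2 hu)]
    have := hK 2 (Ydir e u) 0 (fun a => by rw [← hee]; exact euclidDist_Ydir_lt he he4 hu a)
    rwa [← hee, liftAt_Ydir he he4 hu, gLim_two_eq_contactG h hunit] at this
  -- integrate
  rw [Real.dist_eq]
  have hrepr : contactAvg e m / XiT e (m + 2) - contactG σ =
      v₁⁻¹ * ∫ u in ball (0 : E3) 1, (vcan e (m + 2) (Ydir e u) - contactG σ) := by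
    have hi1 : IntegrableOn (fun u => vcan e (m + 2) (Ydir e u)) (ball (0 : E3) 1) := by
      simp_rw [vcan_Ydir]
      exact (integrableOn_contactDir e m).div_const _
    rw [integral_sub hi1 (integrableOn_const measure_ball_lt_top.ne), setIntegral_const, measureReal_unitBall,
      smul_eq_mul, contactAvg]
    simp_rw [vcan_Ydir]
    rw [integral_div]
    field_simp
  rw [hrepr, abs_mul, abs_of_pos (inv_pos.2 hv)]
  have hbound : |∫ u in ball (0 : E3) 1, (vcan e (m + 2) (Ydir e u) - contactG σ)| ≤ ε / 32 * 4 ^ 2 * v₁ := by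
    have hae : ∀ᵐ u ∂(volume.restrict (ball (0 : E3) 1)), ‖vcan e (m + 2) (Ydir e u) - contactG σ‖ ≤ ε / 32 * 4 ^ 2 := by
      filter_upwards [ae_restrict_of_ae (s := ball (0 : E3) 1) ae_ne_zero] with u hu
      rw [Real.norm_eq_abs]; exact hpt u hu
    have := norm_setIntegral_le_of_norm_le_const_ae measure_ball_lt_top hae
    rwa [Real.norm_eq_abs, measureReal_unitBall] at this
  calc v₁⁻¹ * |∫ u in ball (0 : E3) 1, (vcan e (m + 2) (Ydir e u) - contactG σ)| ≤ v₁⁻¹ * (ε / 32 * 4 ^ 2 * v₁) :=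
        mul_le_mul_of_nonneg_left hbound (by positivity)
    _ = ε / 2 := by field_simp; ring
    _ < ε := by linarith

/-- **The limit of the finite-`N` derivative**: `f_{m+2}'(t) → (v₁/2) g₂(1⁺; t)`. [cite: HansenMcdonald2013, §2.5 (2.5.26)] -/
theorem tendsto_derivFN (h4 : t ^ (1 / 3 : ℝ) < 1 / 4) :
    Tendsto (fun m : ℕ => derivFN m t) atTop (𝓝 (v₁ / 2 * contactG (t ^ (1 / 3 : ℝ)))) := by
  have hc : Tendsto (fun m : ℕ => (m + 1 : ℝ) / (2 * (m + 2))) atTop (𝓝 (1 / 2)) := by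
    have h1 := ((tendsto_natCast_div_add_atTop (1 : ℝ)).comp (tendsto_add_atTop_nat 1)).const_mul (1 / 2 : ℝ)
    rw [mul_one] at h1
    refine h1.congr fun m => ?_
    simp only [Function.comp]
    push_cast
    field_simp
    ring
  have := (hc.mul_const v₁).mul (tendsto_contactAvg_div ht h h4)
  rw [show v₁ / 2 * contactG (t ^ (1 / 3 : ℝ)) = 1 / 2 * v₁ * contactG (t ^ (1 / 3 : ℝ)) by ring]
  exact this.congr fun m => rfl

end DerivLimit

/-! ### From `f_N'` to `f_ex'`: fundamental theorem of calculus, dominated convergence, `limsup` -/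

/-- **`limsup` of a bounded sequence plus a convergent one.** [folklore] -/
theorem limsup_add_of_tendsto {u v : ℕ → ℝ} {B c : ℝ} (hu : ∀ m, |u m| ≤ B) (hv : Tendsto v atTop (𝓝 c)) :
    limsup (fun m => u m + v m) atTop = limsup u atTop + c := by
  have hub : IsBoundedUnder (· ≤ ·) atTop u :=
    isBoundedUnder_of_eventually_le (a := B) (Eventually.of_forall fun m => (abs_le.1 (hu m)).2)
  have huc : IsCoboundedUnder (· ≤ ·) atTop u :=
    isCoboundedUnder_le_of_eventually_le atTop (x := -B) (Eventually.of_forall fun m => (abs_le.1 (hu m)).1)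
  have hv1 : ∀ᶠ m in atTop, v m ≤ c + 1 := hv.eventually (eventually_le_nhds (by linarith))
  have hv2 : ∀ᶠ m in atTop, c - 1 ≤ v m := hv.eventually (eventually_ge_nhds (by linarith))
  have hsb : IsBoundedUnder (· ≤ ·) atTop fun m => u m + v m :=
    isBoundedUnder_of_eventually_le (a := B + (c + 1)) (by
      filter_upwards [hv1] with m hm; linarith [(abs_le.1 (hu m)).2])
  have hsc : IsCoboundedUnder (· ≤ ·) atTop fun m => u m + v m :=
    isCoboundedUnder_le_of_eventually_le atTop (x := -B + (c - 1)) (by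
      filter_upwards [hv2] with m hm; linarith [(abs_le.1 (hu m)).1])
  refine le_antisymm (le_of_forall_pos_le_add fun κ hκ => ?_) (le_of_forall_pos_le_add fun κ hκ => ?_)
  · have hev : ∀ᶠ m in atTop, u m + v m ≤ u m + (c + κ) := by
      filter_upwards [hv.eventually (eventually_le_nhds (by linarith : c < c + κ))] with m hm
      linarith
    have hb' : IsBoundedUnder (· ≤ ·) atTop fun m => u m + (c + κ) :=
      isBoundedUnder_of_eventually_le (a := B + (c + κ)) (Eventually.of_forall fun m => by
        linarith [(abs_le.1 (hu m)).2])
    calc limsup (fun m => u m + v m) atTop ≤ limsup (fun m => u m + (c + κ)) atTop := limsup_le_limsup hev hsc hb'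
      _ = limsup u atTop + (c + κ) := limsup_add_const atTop u (c + κ) hub huc
      _ = limsup u atTop + c + κ := by ring
  · have hev : ∀ᶠ m in atTop, u m + (c - κ) ≤ u m + v m := by
      filter_upwards [hv.eventually (eventually_ge_nhds (by linarith : c - κ < c))] with m hm
      linarith
    have hc' : IsCoboundedUnder (· ≤ ·) atTop fun m => u m + (c - κ) :=
      isCoboundedUnder_le_of_eventually_le atTop (x := -B + (c - κ)) (Eventually.of_forall fun m => by
        linarith [(abs_le.1 (hu m)).1])
    have := limsup_le_limsup hev hc' hsb
    rw [limsup_add_const atTop u (c - κ) hub huc] at this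
    linarith

/-- `Ξ_e(0) = 1`. [folklore] -/
theorem XiT_zero (e : ℝ) : XiT e 0 = 1 := by
  rw [XiT, pinnedXi_zero, if_pos fun a => Fin.elim0 a]

/-- `t^{1/3}` is monotone. [folklore] -/
theorem rpow_third_le_rpow_third {s t : ℝ} (hs : 0 ≤ s) (h : s ≤ t) : s ^ (1 / 3 : ℝ) ≤ t ^ (1 / 3 : ℝ) :=
  Real.rpow_le_rpow hs h (by norm_num)

/-- The infinite-volume integrand `Λ(t) = (v₁/2) g₂(1⁺; t^{1/3})`. [folklore] -/
def Lam (t : ℝ) : ℝ := v₁ / 2 * contactG (t ^ (1 / 3 : ℝ))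

/-- The measurable right derivative `g_m(t) = ∂⁺ f_{m+2}(t)`. [folklore] -/
def gW (m : ℕ) (t : ℝ) : ℝ := derivWithin (fN (m + 2)) (Ioi t) t

/-- `g_m` is measurable. [folklore] -/
theorem measurable_gW (m : ℕ) : Measurable (gW m) := measurable_derivWithin_Ioi (fN (m + 2))

section FTC

variable {σ₁ : ℝ} (hσ₁ : σ₁ ≤ 1 / 4) (hsd : ∀ σ, 0 < σ → σ < σ₁ → SmallDensity uniformProfile σ)
include hσ₁ hsd

/-- `g_m = f_{m+2}'` on the small-density range. [folklore] -/
theorem gW_eq {t : ℝ} (ht : 0 < t) (hts : t ^ (1 / 3 : ℝ) < σ₁) (m : ℕ) : gW m t = derivFN m t := by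
  have h := hsd _ (Real.rpow_pos_of_pos ht _) hts
  have h4 : diam t (m + 2) < 1 / 4 := (diam_le ht.le m).trans_lt (hts.trans_le hσ₁)
  exact (hasDerivWithinAt_fN ht h4 (XiT_diam_pos ht h m)).derivWithin (uniqueDiffWithinAt_Ioi t)

omit hσ₁ in
/-- `0 ≤ f_{m+2}(t) ≤ log 2` on the small-density range. [folklore] -/
theorem fN_mem_Icc {t : ℝ} (ht : 0 < t) (hts : t ^ (1 / 3 : ℝ) < σ₁) (m : ℕ) :
    fN (m + 2) t ∈ Icc (0 : ℝ) (Real.log 2) := by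
  have h := hsd _ (Real.rpow_pos_of_pos ht _) hts
  have hX := XiT_diam_pos ht h m
  have hX1 : XiT (diam t (m + 2)) (m + 2) ≤ 1 := pinnedXi_le_one _ _ _
  have hlow : 1 ≤ 2 ^ (m + 2) * XiT (diam t (m + 2)) (m + 2) := by
    have := XiT_sub_le_pow_mul h (N := m + 1) (n := m + 2) (k := m + 2) (by omega) le_rfl
    rwa [← diam_eq_hsDiameter ht.le, Nat.sub_self, XiT_zero] at this
  have hN : (0 : ℝ) < ((m + 2 : ℕ) : ℝ) := by positivity
  have hlog0 : Real.log (XiT (diam t (m + 2)) (m + 2)) ≤ 0 := Real.log_nonpos hX.le hX1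
  have hlog1 : -(((m + 2 : ℕ) : ℝ) * Real.log 2) ≤ Real.log (XiT (diam t (m + 2)) (m + 2)) := by
    have h2 : Real.log (2 ^ (m + 2) * XiT (diam t (m + 2)) (m + 2)) =
        ((m + 2 : ℕ) : ℝ) * Real.log 2 + Real.log (XiT (diam t (m + 2)) (m + 2)) := by
      rw [Real.log_mul (by positivity) hX.ne', Real.log_pow]
    have := Real.log_nonneg hlow
    linarith
  rw [fN]
  constructor
  · have : 0 ≤ ((m + 2 : ℕ) : ℝ)⁻¹ * (-Real.log (XiT (diam t (m + 2)) (m + 2))) :=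
      mul_nonneg (inv_nonneg.2 hN.le) (by linarith)
    linarith
  · rw [show -((m + 2 : ℕ) : ℝ)⁻¹ * Real.log (XiT (diam t (m + 2)) (m + 2)) =
      ((m + 2 : ℕ) : ℝ)⁻¹ * (-Real.log (XiT (diam t (m + 2)) (m + 2))) by ring]
    calc ((m + 2 : ℕ) : ℝ)⁻¹ * (-Real.log (XiT (diam t (m + 2)) (m + 2)))
        ≤ ((m + 2 : ℕ) : ℝ)⁻¹ * (((m + 2 : ℕ) : ℝ) * Real.log 2) :=
          mul_le_mul_of_nonneg_left (by linarith) (inv_nonneg.2 hN.le)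
      _ = Real.log 2 := by field_simp

/-- `f_{m+2}` is continuous on `[a, b]` in the small-density range. [folklore] -/
theorem continuousOn_fN {a b : ℝ} (ha : 0 < a) (hb : b ^ (1 / 3 : ℝ) < σ₁) (m : ℕ) :
    ContinuousOn (fN (m + 2)) (Icc a b) := by
  have hdiam : Continuous fun t : ℝ => diam t (m + 2) :=
    (Real.continuous_rpow_const (by norm_num)).comp (continuous_id.div_const _)
  have hmaps : MapsTo (fun t => diam t (m + 2)) (Icc a b) (Ioo 0 (1 / 2)) := by
    intro t ht'
    refine ⟨diam_pos (ha.trans_le ht'.1) (by omega), ?_⟩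
    calc diam t (m + 2) ≤ t ^ (1 / 3 : ℝ) := diam_le (ha.le.trans ht'.1) m
      _ ≤ b ^ (1 / 3 : ℝ) := rpow_third_le_rpow_third (ha.le.trans ht'.1) ht'.2
      _ < 1 / 2 := by linarith
  have hX : ContinuousOn (fun t => XiT (diam t (m + 2)) (m + 2)) (Icc a b) :=
    (continuousOn_XiT (m + 2)).comp hdiam.continuousOn hmaps
  have hX0 : ∀ t ∈ Icc a b, XiT (diam t (m + 2)) (m + 2) ≠ 0 := by
    intro t ht'
    have ht0 : 0 < t := ha.trans_le ht'.1
    exact (XiT_diam_pos ht0 (hsd _ (Real.rpow_pos_of_pos ht0 _)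
      ((rpow_third_le_rpow_third ht0.le ht'.2).trans_lt hb)) m).ne'
  show ContinuousOn (fun t => -((m + 2 : ℕ) : ℝ)⁻¹ * Real.log (XiT (diam t (m + 2)) (m + 2))) (Icc a b)
  exact continuousOn_const.mul (hX.log hX0)

/-- **FTC for the finite-`N` free energy**: `∫_a^b g_m = f_{m+2}(b) − f_{m+2}(a)`. [folklore] -/
theorem integral_gW_eq {a b : ℝ} (ha : 0 < a) (hab : a ≤ b) (hb : b ^ (1 / 3 : ℝ) < σ₁) (m : ℕ) :
    ∫ t in a..b, gW m t = fN (m + 2) b - fN (m + 2) a := by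
  have hv := v₁_pos
  have hsmall : ∀ t ∈ Icc a b, 0 < t ∧ t ^ (1 / 3 : ℝ) < σ₁ := fun t ht' =>
    ⟨ha.trans_le ht'.1, (rpow_third_le_rpow_third (ha.le.trans ht'.1) ht'.2).trans_lt hb⟩
  refine intervalIntegral.integral_eq_sub_of_hasDeriv_right_of_le hab (continuousOn_fN hσ₁ hsd ha hb m)
    (fun t ht' => ?_) ?_
  · obtain ⟨ht0, hts⟩ := hsmall t (Ioo_subset_Icc_self ht')
    have h := hsd _ (Real.rpow_pos_of_pos ht0 _) hts
    have h4 : diam t (m + 2) < 1 / 4 := (diam_le ht0.le m).trans_lt (hts.trans_le hσ₁)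
    exact (hasDerivWithinAt_fN ht0 h4 (XiT_diam_pos ht0 h m)).differentiableWithinAt.hasDerivWithinAt
  · rw [intervalIntegrable_iff_integrableOn_Ioc_of_le hab]
    refine Measure.integrableOn_of_bounded (M := 2 * v₁) measure_Ioc_lt_top.ne
      (measurable_gW m).aestronglyMeasurable ?_
    refine (ae_restrict_iff' measurableSet_Ioc).2 (ae_of_all _ fun t ht' => ?_)
    obtain ⟨ht0, hts⟩ := hsmall t (Ioc_subset_Icc_self ht')
    have h := hsd _ (Real.rpow_pos_of_pos ht0 _) hts
    rw [gW_eq hσ₁ hsd ht0 hts, Real.norm_eq_abs, abs_of_nonneg (derivFN_mem_Icc ht0 h m).1]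
    exact (derivFN_mem_Icc ht0 h m).2

/-- **Dominated convergence**: `∫_a^b g_m → ∫_a^b Λ`. [folklore] -/
theorem tendsto_integral_gW {a b : ℝ} (ha : 0 < a) (hab : a ≤ b) (hb : b ^ (1 / 3 : ℝ) < σ₁) :
    Tendsto (fun m => ∫ t in a..b, gW m t) atTop (𝓝 (∫ t in a..b, Lam t)) := by
  have hv := v₁_pos
  simp_rw [intervalIntegral.integral_of_le hab]
  have hsmall : ∀ t ∈ Ioc a b, 0 < t ∧ t ^ (1 / 3 : ℝ) < σ₁ := fun t ht' =>
    ⟨ha.trans ht'.1, (rpow_third_le_rpow_third (ha.le.trans ht'.1.le) ht'.2).trans_lt hb⟩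
  refine tendsto_integral_of_dominated_convergence (fun _ => 2 * v₁)
    (fun m => (measurable_gW m).aestronglyMeasurable) (integrableOn_const measure_Ioc_lt_top.ne) (fun m => ?_) ?_
  · refine (ae_restrict_iff' measurableSet_Ioc).2 (ae_of_all _ fun t ht' => ?_)
    obtain ⟨ht0, hts⟩ := hsmall t ht'
    have h := hsd _ (Real.rpow_pos_of_pos ht0 _) hts
    rw [gW_eq hσ₁ hsd ht0 hts, Real.norm_eq_abs, abs_of_nonneg (derivFN_mem_Icc ht0 h m).1]
    exact (derivFN_mem_Icc ht0 h m).2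
  · refine (ae_restrict_iff' measurableSet_Ioc).2 (ae_of_all _ fun t ht' => ?_)
    obtain ⟨ht0, hts⟩ := hsmall t ht'
    have h := hsd _ (Real.rpow_pos_of_pos ht0 _) hts
    have e : (fun m => gW m t) = fun m => derivFN m t := funext fun m => gW_eq hσ₁ hsd ht0 hts m
    rw [e]
    exact tendsto_derivFN ht0 h (hts.trans_le hσ₁)

/-- **The excess free energy is the integral of `Λ`**: `f_ex(b) − f_ex(a) = ∫_a^b Λ`
on the small-density range. [cite: HansenMcdonald2013, §2.5 (2.5.26)] -/
theorem hsExcessFreeEnergy_sub_eq {a b : ℝ} (ha : 0 < a) (hab : a ≤ b) (hb : b ^ (1 / 3 : ℝ) < σ₁) :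
    hsExcessFreeEnergy b - hsExcessFreeEnergy a = ∫ t in a..b, Lam t := by
  have has : a ^ (1 / 3 : ℝ) < σ₁ := (rpow_third_le_rpow_third ha.le hab).trans_lt hb
  have hb0 : 0 < b := ha.trans_le hab
  rw [hsExcessFreeEnergy_eq_limsup hb0, hsExcessFreeEnergy_eq_limsup ha]
  have e : (fun m : ℕ => fN (m + 2) b) = fun m => fN (m + 2) a + ∫ t in a..b, gW m t := by
    funext m; rw [integral_gW_eq hσ₁ hsd ha hab hb m]; ring
  rw [e, limsup_add_of_tendsto (B := Real.log 2) (fun m => ?_) (tendsto_integral_gW hσ₁ hsd ha hab hb)]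
  · ring
  · have := fN_mem_Icc hsd ha has m
    rw [abs_of_nonneg this.1]; exact this.2

omit hσ₁ in
/-- `Λ` is continuous on the small-density range. [folklore] -/
theorem continuousAt_Lam (hσ₁1 : σ₁ ≤ 1) {t : ℝ} (ht : 0 < t) (hts : t ^ (1 / 3 : ℝ) < σ₁) : ContinuousAt Lam t := by
  have h1 : ContinuousAt (fun t : ℝ => t ^ (1 / 3 : ℝ)) t := Real.continuousAt_rpow_const t _ (Or.inl ht.ne')
  have h2 : ContinuousAt contactG (t ^ (1 / 3 : ℝ)) :=
    continuousAt_contactG hσ₁1 hsd (Real.rpow_pos_of_pos ht _) hts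
  have h3 : ContinuousAt (fun t : ℝ => contactG (t ^ (1 / 3 : ℝ))) t :=
    ContinuousAt.comp (f := fun t : ℝ => t ^ (1 / 3 : ℝ)) (x := t) h2 h1
  show ContinuousAt (fun t => v₁ / 2 * contactG (t ^ (1 / 3 : ℝ))) t
  exact h3.const_mul _

/-- **The excess free energy is differentiable with `f_ex'(σ³) = (v₁/2) g₂(1⁺; σ)`**
on the small-density range. [cite: HansenMcdonald2013, §2.5 (2.5.26)] -/
theorem hasDerivAt_hsExcessFreeEnergy {σ₀ : ℝ} (h0 : 0 < σ₀) (h1 : σ₀ < σ₁) :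
    HasDerivAt hsExcessFreeEnergy (Lam (σ₀ ^ 3)) (σ₀ ^ 3) := by
  have hσ₁1 : σ₁ ≤ 1 := hσ₁.trans (by norm_num)
  set η₀ := σ₀ ^ 3 with hη₀
  have hη₀0 : 0 < η₀ := pow_pos h0 3
  set a := η₀ / 2 with ha
  have ha0 : 0 < a := by positivity
  have haη : a < η₀ := by rw [ha]; linarith
  -- an upper point `b₀` with `b₀^{1/3} < σ₁` above `η₀`
  set b₀ := ((σ₀ + σ₁) / 2) ^ 3 with hb₀
  have hmid0 : 0 < (σ₀ + σ₁) / 2 := by linarith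
  have hb₀root : b₀ ^ (1 / 3 : ℝ) = (σ₀ + σ₁) / 2 := pow_three_rpow_third hmid0.le
  have hb₀σ : b₀ ^ (1 / 3 : ℝ) < σ₁ := by rw [hb₀root]; linarith
  have hηb : η₀ < b₀ := by
    rw [hη₀, hb₀]; exact pow_lt_pow_left₀ (by linarith) h0.le (by norm_num)
  have hsmallt : ∀ t ∈ Ioo a b₀, 0 < t ∧ t ^ (1 / 3 : ℝ) < σ₁ := fun t ht' =>
    ⟨ha0.trans ht'.1, (rpow_third_le_rpow_third (ha0.trans ht'.1).le ht'.2.le).trans_lt hb₀σ⟩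
  -- `f_ex = f_ex(a) + ∫_a^· Λ` near `η₀`
  have hrep : hsExcessFreeEnergy =ᶠ[𝓝 η₀] fun η => hsExcessFreeEnergy a + ∫ t in a..η, Lam t := by
    filter_upwards [Ioo_mem_nhds haη hηb] with η hη
    have := hsExcessFreeEnergy_sub_eq hσ₁ hsd ha0 hη.1.le
      ((rpow_third_le_rpow_third (ha0.trans hη.1).le hη.2.le).trans_lt hb₀σ)
    linarith
  -- FTC-2 for the continuous integrand
  have hcontU : ContinuousOn Lam (Ioo a b₀) := fun t ht' =>
    (continuousAt_Lam hsd hσ₁1 (hsmallt t ht').1 (hsmallt t ht').2).continuousWithinAt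
  have hη₀U : η₀ ∈ Ioo a b₀ := ⟨haη, hηb⟩
  have hint : IntervalIntegrable Lam volume a η₀ := by
    refine ContinuousOn.intervalIntegrable ?_
    rw [uIcc_of_le haη.le]
    intro t ht'
    have ht0 : 0 < t := ha0.trans_le ht'.1
    have hts : t ^ (1 / 3 : ℝ) < σ₁ :=
      (rpow_third_le_rpow_third ht0.le (ht'.2.trans hηb.le)).trans_lt hb₀σ
    exact (continuousAt_Lam hsd hσ₁1 ht0 hts).continuousWithinAt
  have hmeas : StronglyMeasurableAtFilter Lam (𝓝 η₀) volume :=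
    ContinuousOn.stronglyMeasurableAtFilter isOpen_Ioo hcontU η₀ hη₀U
  have hD := intervalIntegral.integral_hasDerivAt_right hint hmeas
    (continuousAt_Lam hsd hσ₁1 hη₀0 (by rw [hη₀, pow_three_rpow_third h0.le]; exact h1))
  exact (hD.const_add (hsExcessFreeEnergy a)).congr_of_eventuallyEq hrep

/-- **The virial theorem for the contact value**: `contactValue (σ³) = g₂(1⁺; σ)`,
i.e. `f_ex'(η) = (2π/3) g₂(1⁺)` with `v₁ = 4π/3`. [cite: HansenMcdonald2013, §2.5 (2.5.26)] -/
theorem contactValue_eq_contactG {σ₀ : ℝ} (h0 : 0 < σ₀) (h1 : σ₀ < σ₁) : contactValue (σ₀ ^ 3) = contactG σ₀ := by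
  rw [contactValue, (hasDerivAt_hsExcessFreeEnergy hσ₁ hsd h0 h1).deriv, Lam, pow_three_rpow_third h0.le, v₁_eq]
  field_simp
  ring

end FTC

/-! ### The canonical pair law at contact scale -/

/-- `hardCoreSet (Ov ε) univ = hcSet ε n`. [folklore] -/
theorem hardCoreSet_univ_eq_hcSet (ε : ℝ) (n : ℕ) :
    (StatisticalMechanics.hardCoreSet (Ov ε) (Finset.univ : Finset (Fin n)) : Set (Fin n → T3)) = hcSet ε n := by
  ext x
  simp [StatisticalMechanics.hardCoreSet, hcSet]

/-- `Ξ_ε(n) = hcProb (Ov ε) vol univ`. [folklore] -/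
theorem XiT_eq_hcProb (ε : ℝ) (n : ℕ) :
    XiT ε n = StatisticalMechanics.hcProb (Ov ε) (volume : Measure T3) (Finset.univ : Finset (Fin n)) := by
  rw [XiT, pinnedXi_elim0_eq_hcProb]

/-- **Exchangeability**: the hard-core pair event `{x_i − x_j ∈ T}` has the measure of `{x_1 − x_0 ∈ T}`,
`= ∫_T u_e(y, 0)(m) dy`. [folklore] -/
theorem measureReal_hcSet_inter_pairEvent_ij (e : ℝ) (m : ℕ) {i j : Fin (m + 2)} (hij : i ≠ j) {T : Set T3}
    (hT : MeasurableSet T) :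
    volume.real (hcSet e (m + 2) ∩ {x | x i - x j ∈ T}) = ∫ y in T, pinnedXi e ![y, 0] m := by
  obtain ⟨τ, hτ1, hτ0⟩ := exists_perm_pair (n := m + 2) (a := 1) (b := 0) (c := i) (d := j) (by simp) hij
  have hmeas : MeasurableSet (hcSet e (m + 2) ∩ {x : Fin (m + 2) → T3 | x 1 - x 0 ∈ T}) :=
    (measurableSet_hcSet e _).inter (measurableSet_pairEvent (n := m + 2) 1 0 hT)
  have hpre : (fun x : Fin (m + 2) → T3 => x ∘ τ) ⁻¹' (hcSet e (m + 2) ∩ {x | x 1 - x 0 ∈ T}) =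
      hcSet e (m + 2) ∩ {x | x i - x j ∈ T} := by
    ext x
    simp only [mem_preimage, mem_inter_iff, comp_perm_mem_hcSet_iff, mem_setOf_eq, Function.comp_apply, hτ1, hτ0]
  rw [← measureReal_hcSet_inter_pairEvent e m hT, ← hpre, measureReal_def, measureReal_def,
    (measurePreserving_comp_perm τ).measure_preimage hmeas.nullMeasurableSet]

/-- **The canonical pair law as a pinned integral**:
`posGibbsMeasure 1 ε (m+2) {x_i − x_j ∈ T} = Ξ_ε(m+2)⁻¹ ∫_T u_ε(y, 0)(m) dy`. [folklore] -/
theorem posGibbs_real_pairEvent (ε : ℝ) (m : ℕ) {i j : Fin (m + 2)} (hij : i ≠ j) {T : Set T3}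
    (hT : MeasurableSet T) :
    (posGibbsMeasure (fun _ => (1 : ℝ)) ε (m + 2)).real {x | x i - x j ∈ T} =
      (XiT ε (m + 2))⁻¹ * ∫ y in T, pinnedXi ε ![y, 0] m := by
  have hE := measurableSet_pairEvent (n := m + 2) i j hT
  rw [measureReal_def, posGibbsMeasure_eq continuous_const (fun _ => one_pos) ε (m + 2), Measure.smul_apply,
    smul_eq_mul, Measure.restrict_apply hE, profileOf_one_μ, Xi, firstLabels_self, profileOf_one_μ, Set.inter_comm,
    ENNReal.toReal_mul, ENNReal.toReal_ofReal (inv_nonneg.2 (StatisticalMechanics.hcProb_nonneg _ _)),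
    ← XiT_eq_hcProb, hardCoreSet_univ_eq_hcSet, ← volume_pi, ← measureReal_def,
    measureReal_hcSet_inter_pairEvent_ij ε m hij hT]

/-- **The chart for pinned pair integrals**: `∫_{reprSym ∈ A} u_ε(y,0)(m) dy = ∫_A ψ_ε(u) du` for
`A ⊆ B(0, 1/2)`. [folklore] -/
theorem setIntegral_pinned_chart (ε : ℝ) (m : ℕ) {A : Set E3} (hA : MeasurableSet A) (hAsub : A ⊆ ball 0 (1 / 2)) :
    ∫ y in Torus.reprSym ⁻¹' A, pinnedXi ε ![y, 0] m = ∫ u in A, psiE ε m u := by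
  have hT : MeasurableSet (Torus.reprSym ⁻¹' A : Set T3) := Torus.measurable_reprSym hA
  set G : T3 → ℝ := (Torus.reprSym ⁻¹' A : Set T3).indicator fun y => pinnedXi ε ![y, 0] m with hG
  have hGm : Measurable G := (measurable_pinnedXi_comp ε measurable_vec2 m).indicator hT
  rw [← integral_indicator hT]
  have step1 : ∫ y : T3, G y = ∫ u in Torus.symCube (Fin 3), G (Torus.proj u) := by
    rw [← Torus.map_proj_volume_restrict_symCube (d := Fin 3),
      integral_map Torus.measurable_proj.aemeasurable hGm.aestronglyMeasurable]
  have step2 : ∫ u in Torus.symCube (Fin 3), G (Torus.proj u) = ∫ u in Torus.symCube (Fin 3), A.indicator (psiE ε m) u := by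
    refine setIntegral_congr_fun Torus.measurableSet_symCube fun u hu => ?_
    simp only [hG, indicator, mem_preimage, reprSym_proj_of_mem_symCube' hu, psiE]
  have step3 : ∫ u in Torus.symCube (Fin 3), A.indicator (psiE ε m) u = ∫ u, A.indicator (psiE ε m) u := by
    refine setIntegral_eq_integral_of_forall_compl_eq_zero fun u hu => ?_
    refine indicator_of_notMem (fun hb => hu (mem_symCube_of_norm_lt ?_)) _
    have := hAsub hb
    rwa [mem_ball, dist_zero_right] at this
  rw [show (fun y => (Torus.reprSym ⁻¹' A : Set T3).indicator (fun y => pinnedXi ε ![y, 0] m) y) = G from rfl,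
    step1, step2, step3, integral_indicator hA]

/-- The Lipschitz constant of `q ↦ g₂(q, 0)` near contact. [folklore] -/
def Lip (σ : ℝ) : ℝ := 36 * Real.exp (σ ^ 3 * v₁ * 6)

/-- `ψ` is integrable on sets of finite measure. [folklore] -/
theorem integrableOn_psiE (ε : ℝ) (m : ℕ) {A : Set E3} (hA : volume A < ∞) : IntegrableOn (psiE ε m) A :=
  Measure.integrableOn_of_bounded (M := 1) hA.ne (measurable_psiE ε m).aestronglyMeasurable
    (ae_of_all _ fun u => by
      rw [Real.norm_eq_abs, abs_of_nonneg (psiE_mem_Icc ε m u).1]; exact (psiE_mem_Icc ε m u).2)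

/-- **The canonical pair law at contact scale versus the infinite-volume contact value.**
Under `KSInv` with window `3ε` and accuracy `δ_K`, for `S ⊆ {1 < ‖q‖ ≤ 1 + δ}` (`δ ≤ 1`):
`|P(x_i − x_j ∈ εS) − g₂(1⁺) ε³ vol S| ≤ (16 δ_K + Lip δ) ε³ vol S`. [folklore] -/
theorem pair_estimate {σ : ℝ} (h : SmallDensity uniformProfile σ) (hσ4 : σ < 1 / 4) {δK δ : ℝ}
    (hδ : 0 < δ) (hδ1 : δ ≤ 1) (m : ℕ) (hK : KSInv σ (m + 1) (m + 2) (3 * hsDiameter σ (m + 1)) δK)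
    {i j : Fin (m + 2)} (hij : i ≠ j) {S : Set E3} (hS : MeasurableSet S)
    (hSsub : S ⊆ {q | 1 < ‖q‖ ∧ ‖q‖ ≤ 1 + δ}) :
    |(posGibbsMeasure (fun _ => (1 : ℝ)) (hsDiameter σ (m + 1)) (m + 2)).real
        {x | Torus.reprSym (x i - x j) ∈ hsDiameter σ (m + 1) • S}
      - contactG σ * hsDiameter σ (m + 1) ^ 3 * (volume S).toReal|
      ≤ (16 * δK + Lip σ * δ) * hsDiameter σ (m + 1) ^ 3 * (volume S).toReal := by
  set ε := hsDiameter σ (m + 1) with hεdef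
  have hε : 0 < ε := hsDiameter_pos h.σ_pos _
  have hε4 : ε < 1 / 4 := (hsDiameter_le h.σ_pos.le _).trans_lt hσ4
  have hX := XiT_pos h (N := m + 1) (m := m + 2) le_rfl
  have hLip : 0 ≤ Lip σ := by unfold Lip; positivity
  -- geometry of `S`
  have hSq : ∀ q ∈ S, 1 < ‖q‖ ∧ ‖q‖ ≤ 1 + δ := fun q hq => hSsub hq
  have hSball : S ⊆ ball (0 : E3) 3 := fun q hq => by
    rw [mem_ball, dist_zero_right]; linarith [(hSq q hq).2]
  have hSfin : volume S < ∞ := (measure_mono hSball).trans_lt measure_ball_lt_top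
  have hεS : MeasurableSet (ε • S) := hS.const_smul₀ ε
  have hεSsub : ε • S ⊆ ball (0 : E3) (1 / 2) := by
    rintro _ ⟨q, hq, rfl⟩
    rw [mem_ball, dist_zero_right, norm_smul, Real.norm_eq_abs, abs_of_pos hε]
    nlinarith [(hSq q hq).2]
  -- the pair law as an integral over `S`
  set Yq : E3 → Fin 2 → T3 := fun q => ![Torus.proj (ε • q), 0] with hYq
  have hYm : Measurable Yq := measurable_vec2.comp (Torus.measurable_proj.comp (measurable_const_smul ε))
  have hP : (posGibbsMeasure (fun _ => (1 : ℝ)) ε (m + 2)).real {x | Torus.reprSym (x i - x j) ∈ ε • S} =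
      ε ^ 3 * ∫ q in S, vcan ε (m + 2) (Yq q) := by
    have e1 : {x : Fin (m + 2) → T3 | Torus.reprSym (x i - x j) ∈ ε • S} =
        {x | x i - x j ∈ (Torus.reprSym ⁻¹' (ε • S) : Set T3)} := rfl
    rw [e1, posGibbs_real_pairEvent ε m hij (Torus.measurable_reprSym hεS), setIntegral_pinned_chart ε m hεS hεSsub]
    have e2 := Measure.setIntegral_comp_smul_of_pos (volume : Measure E3) (psiE ε m) S hε
    rw [finrank_euclideanSpace_fin, smul_eq_mul] at e2
    have e3 : ∫ u in ε • S, psiE ε m u = ε ^ 3 * ∫ q in S, psiE ε m (ε • q) := by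
      rw [e2, ← mul_assoc, mul_inv_cancel₀ (pow_ne_zero 3 hε.ne'), one_mul]
    rw [e3]
    have e4 : ∀ q, vcan ε (m + 2) (Yq q) = psiE ε m (ε • q) / XiT ε (m + 2) := fun q => by
      rw [vcan, Nat.add_sub_cancel, hYq, psiE]
    simp_rw [e4]
    rw [integral_div]
    field_simp
  -- pointwise estimate on `S`
  have hpt : ∀ q ∈ S, |vcan ε (m + 2) (Yq q) - contactG σ| ≤ 16 * δK + Lip σ * δ := by
    intro q hq
    obtain ⟨hq1, hq2⟩ := hSq q hq
    have hnq : ‖ε • q‖ = ε * ‖q‖ := by rw [norm_smul, Real.norm_eq_abs, abs_of_pos hε]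
    have hnq2 : ‖ε • q‖ < 1 / 2 := by rw [hnq]; nlinarith
    have hwin : ∀ a, Torus.euclidDist (Yq q a) 0 < 3 * ε := by
      intro a
      refine Fin.cases ?_ (fun b => ?_) a
      · show Torus.euclidDist (Torus.proj (ε • q)) 0 < 3 * ε
        rw [euclidDist_proj_zero hnq2, hnq]; nlinarith
      · fin_cases b
        show Torus.euclidDist (0 : T3) 0 < 3 * ε
        rw [Torus.euclidDist_self]; linarith
    have hlift : liftAt ε 0 (Yq q) = ![q, 0] := by
      funext a
      refine Fin.cases ?_ (fun b => ?_) a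
      · show ε⁻¹ • Torus.reprSym (Torus.proj (ε • q) - 0) = q
        rw [sub_zero, reprSym_proj_of_norm_lt hnq2, smul_smul, inv_mul_cancel₀ hε.ne', one_smul]
      · fin_cases b
        show ε⁻¹ • Torus.reprSym ((0 : T3) - 0) = 0
        rw [sub_zero, Torus.reprSym_zero, smul_zero]
    have h1 := hK 2 (Yq q) 0 hwin
    rw [hlift] at h1
    have h2 := abs_gLim_two_sub_contactG_le h hq1.le (by linarith)
    have h3 : Lip σ * (‖q‖ - 1) ≤ Lip σ * δ := mul_le_mul_of_nonneg_left (by linarith) hLip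
    calc |vcan ε (m + 2) (Yq q) - contactG σ|
        ≤ |vcan ε (m + 2) (Yq q) - gLim σ 2 ![q, 0]| + |gLim σ 2 ![q, 0] - contactG σ| := abs_sub_le _ _ _
      _ ≤ δK * 4 ^ 2 + Lip σ * (‖q‖ - 1) := add_le_add h1 h2
      _ ≤ 16 * δK + Lip σ * δ := by linarith
  -- integrate
  have hint : IntegrableOn (fun q => vcan ε (m + 2) (Yq q)) S :=
    Measure.integrableOn_of_bounded (M := 2 ^ 2) hSfin.ne (measurable_vcan_comp ε (m + 2) hYm).aestronglyMeasurable
      (ae_of_all _ fun q => abs_vcan_le h (N := m + 1) (n := m + 2) le_rfl (Yq q))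
  have hdiff : (posGibbsMeasure (fun _ => (1 : ℝ)) ε (m + 2)).real {x | Torus.reprSym (x i - x j) ∈ ε • S} -
      contactG σ * ε ^ 3 * (volume S).toReal = ε ^ 3 * ∫ q in S, (vcan ε (m + 2) (Yq q) - contactG σ) := by
    rw [hP, integral_sub hint (integrableOn_const hSfin.ne), setIntegral_const, measureReal_def, smul_eq_mul]
    ring
  rw [hdiff, abs_mul, abs_of_pos (pow_pos hε 3)]
  have hI : |∫ q in S, (vcan ε (m + 2) (Yq q) - contactG σ)| ≤ (16 * δK + Lip σ * δ) * (volume S).toReal := by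
    have := norm_setIntegral_le_of_norm_le_const hSfin (fun q hq => by
      rw [Real.norm_eq_abs]; exact hpt q hq) (f := fun q => vcan ε (m + 2) (Yq q) - contactG σ)
    rwa [Real.norm_eq_abs, measureReal_def] at this
  calc ε ^ 3 * |∫ q in S, (vcan ε (m + 2) (Yq q) - contactG σ)| ≤ ε ^ 3 * ((16 * δK + Lip σ * δ) * (volume S).toReal) :=
        mul_le_mul_of_nonneg_left hI (pow_nonneg hε.le 3)
    _ = (16 * δK + Lip σ * δ) * ε ^ 3 * (volume S).toReal := by ring

/-! ### The contact theorem -/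

/-- **The contact theorem for the canonical hard-sphere gas on `𝕋³` at low density**
(discharge of the named fact `HardSphereContactTheorem`): at small reduced density, the rescaled
near-contact pair law of the canonical gas converges, uniformly on thin shells, to the contact value
`contactValue (σ³) = g₂(1⁺)` given by the virial theorem `f_ex'(η) = (2π/3) g₂(1⁺)`.
[cite: HansenMcdonald2013, §2.5 (2.5.22), (2.5.26)] [cite: Ruelle1969, §4.2.3 Thm 4.2.3]
[cite: PulvirentiTsagkarogiannis2012, Thm 2] -/
theorem HardSphereContactTheorem_holds : HardSphereContactTheorem := by
  obtain ⟨σ₀, hσ₀, hsd0⟩ := exists_smallDensity uniformProfile one_pos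
  set σ₁ := min σ₀ (1 / 4 : ℝ) with hσ₁
  have hsd : ∀ σ, 0 < σ → σ < σ₁ → SmallDensity uniformProfile σ := fun σ h0 h1 =>
    (hsd0 σ h0 (h1.trans_le (min_le_left _ _))).1
  have hσ₁4 : σ₁ ≤ 1 / 4 := min_le_right _ _
  refine ⟨σ₁, lt_min hσ₀ (by norm_num), fun σ hσ hσ1 ζ hζ => ?_⟩
  have h := hsd σ hσ hσ1
  have hσ4 : σ < 1 / 4 := hσ1.trans_le hσ₁4
  have hL : 0 < Lip σ := by unfold Lip; positivity
  refine ⟨min 1 (ζ / (2 * Lip σ)), lt_min one_pos (by positivity), fun δ hδ hδ1 => ?_⟩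
  have hδ1' : δ ≤ 1 := hδ1.trans (min_le_left _ _)
  have hδζ : Lip σ * δ ≤ ζ / 2 := by
    calc Lip σ * δ ≤ Lip σ * (ζ / (2 * Lip σ)) := mul_le_mul_of_nonneg_left (hδ1.trans (min_le_right _ _)) hL.le
      _ = ζ / 2 := by field_simp
  have hδK : (0 : ℝ) < ζ / 32 := by positivity
  obtain ⟨N₁, hN₁⟩ := eventually_atTop.1 (ksInv_eventually h 3 hδK)
  refine ⟨max N₁ 1, fun N hN i j hij S hS hSsub => ?_⟩
  obtain ⟨m, rfl⟩ : ∃ m, N = m + 1 := ⟨N - 1, by omega⟩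
  have hK := hN₁ (m + 1) (le_of_max_le_left hN)
  have hest := pair_estimate h hσ4 hδ hδ1' m hK hij hS hSsub
  rw [contactValue_eq_contactG hσ₁4 hsd hσ hσ1]
  refine hest.trans ?_
  have hsum : 16 * (ζ / 32) + Lip σ * δ ≤ ζ := by linarith
  exact mul_le_mul_of_nonneg_right (mul_le_mul_of_nonneg_right hsum (pow_nonneg (hsDiameter_pos hσ _).le 3))
    ENNReal.toReal_nonneg

end Literature.MathematicalPhysics.StatisticalMechanics

end
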